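import Literature.AlgebraicGeometry.HodgeTheory.AbelianFourfoldEndRankOneHodgeClasses
import Literature.AlgebraicGeometry.HodgeTheory.RibetTypeThreeCoprimePowersHodgeClasses
import Literature.AlgebraicGeometry.HodgeTheory.WeilTypeHodgeLieNoThinCorner
import Literature.AlgebraicGeometry.Milne1999.HodgeGroupPowersDiagonal
import Literature.AlgebraicGeometry.VanGeemen1994.HodgeGroupLeSUWeilType
import Literature.RepresentationTheory.ClassicalInvariants.MixedTensorLieInvariantsSL
import HarnessLib

/-!
# The Lie-to-group passage for abelian varieties of Weil type with `End⁰ = K`: «`Lie Hg(H¹A) ⊗ ℂ ⊇ 𝔰𝔲_K`» ⟹ «`Hg(A)(ℂ)|_{H¹} ⊇ S(A)(ℂ) ∩ {det_W = 1}`» (Deligne's rigidity + unipotent generation of `SL(W)`; the socket B5a of the (3|3) Weil square of TABLE X row 9)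

Family `hodge`, layer `Literature/AlgebraicGeometry/HodgeTheory`, namespace `Literature.AlgebraicGeometry.HodgeTheory`
(D-0022). THEOREMS ONLY: no definition, no named fact, no `sorry` (D-0026). Written for the cell `pub-hodgeav-hg6`
(HC for abelian varieties of dimension ≤ 5 + the dimension-6 Hodge-group exception table, req-37 (A) Q2b), seat
`eng-3 g3`, as brick **B5a = S5** of `HOME/jobs/WEIL33-eng4g7/DESIGN.md` rev 3 §6 (iv). HONEST FRAMING: HC, `HC_AV`
(item 1333), `HC_CM` (item 3052) and rung H2 are NOT proved and do not occur here; the Lie-level input «`Lie Hg ⊇ 𝔰𝔲_K`»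
(brick B4′ = `IsWeilType.mem_hodgeLieC_of_commute_of_skew_of_trace`, NOT yet a tree theorem) enters ONLY as the
DISPLAYED hypothesis `hSU`, stated verbatim in the shape of DESIGN §6 (i)/(ii) so that B4′ plugs in by `exact`.

## The statement and its place

For a complex abelian variety `A` with `(A, φ)` of Weil type `(n, d)` (`φ² = −d`, `K = ℚ(φ)`, van Geemen 4.9) and
`End⁰(A) = K` (`finrank_ℚ End⁰(A) = 2`), the census files of TABLE X (rows 9 / 11 / 13 / 17 / 19 / 20 / 22 / 27;
`Summits/…/Theorems/SixfoldTableXCensusWeilCMGeneralRows*`, `…WeilCentralKGeneral`, `…WeilGeneralRow`) display the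
GROUP-LEVEL general-member hypothesis

  `hG : ∀ u ∈ S(A)(ℂ) = Milne1999.unitaryCentralizerGroup A h, det(u | W_{i√d}) = 1 → u ∈ Hg(A)(ℂ)|_{H¹}`

(`W_{i√d} = ker(φ^* − i√d) ⊆ H¹(A(ℂ); ℂ)`; `Hg(A)(ℂ)|_{H¹} = VanGeemen1994.hodgeGroupOne`, the degree-one component of the
tree's Tannaka-free Hodge group: Künneth families on the powers `A^{a+1}` fixing every rational `(p,p)`-class), resp.
van Geemen's `HasHodgeGroupSU A φ n d h` (`Hg|_{H¹} = SU_H(ℂ)`, Thm. 6.11/6.12). The (3|3) Weil square (eng-4 g7,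
bricks W4–W6, B1, S0–S4) proves the LIE-LEVEL statement «every `φ_ℂ`-commuting, `ψ_ℂ`-skew operator with trace `0`
on `W` lies in `Lie Hg(H¹A) ⊗ ℂ`» (B4′). This file is the passage from the Lie statement to the group statement.

## The argument (Deligne I §3 + Goodman–Wallach Thm. 2.2.2 / 2.2.7 (2), on the tree's carriers)

Let `ψ` be a polarization of the `ℚ`-Hodge structure `H¹(A(ℂ); ℚ)` and `(e_ℓ, f_ℓ)_ℓ` adapted `ψ_ℂ`-dual bases of
`V_ℂ = W ⊕ W̄` (`UnitaryTheta.exists_adaptedDualBasis`).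
1. (§1, INVARIANCE) Every rational `(p,p)`-class on an abelian variety `B` with slots over `A` (all powers `A^{a+1}`)
   is `∑_w a(w)·(g e, g f)_w` for a coefficient function `a` whose slices are killed by the typed differential
   (`X` on the `W`-letters, `−Xᵀ` on the `W̄`-letters) of every TRACELESS `X ∈ 𝔰𝔩(W)`: the operator `Y_X = X ⊕ (−Xᵀ)`
   commutes with `φ_ℂ`, is `ψ_ℂ`-skew and has trace `tr X = 0` on `W`, so lies in `Lie Hg ⊗ ℂ` by `hSU`, and
   Theorem L-Hg (`wordDerAt_eq_zero_of_mem_hodgeLieC`: Deligne's rigidity, `Lie Hg` kills the rational Hodge tensors)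
   applies — verbatim the tree's `AVSlots.exists_unitaryInvariant_coeff_threeCoprime` with `hSU` for THEOREM L⁗.
2. (§2, THE GROUP ACTS ON COEFFICIENTS) For `v ∈ C(A)^×(ℂ)` acting blockwise on the letters, `⋀•(v^{⊕(a+1)})`
   (`Milne1999.diagPowExterior`) acts on `∑_w a(w)·(g e, g f)_w` through the slot-wise colour change of `a`
   (`colourChangeAt`; `diagPow_intertwine_right`, `exteriorPullback_cupPowOne`, multilinearity).
3. (§3, `SU ⊆ Hg`) If `v₀ ∈ GL(V_ℂ)` commutes with `φ_ℂ`, preserves `ψ_ℂ` and has `det(v₀|_W) = 1`, its matrix on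
   the adapted letters is `(M, (M⁻¹)ᵀ)` with `det M = 1`, so every slice is FIXED
   (`ClassicalInvariants.wordRepAt_mixedGrpFamily_eq_self_of_forall_trace_of_det_eq_one`: `SL(W)` is generated by
   transvections `1 + cE_{ij}` — exponentials of square-zero traceless elements — and its determinant-one torus);
   hence `⋀•(v^{⊕(a+1)})` fixes every Hodge class of every power and `v ∈ Hg(A)(ℂ)|_{H¹}`
   (`Milne1999.exteriorPullbackEquiv_mem_hodgeGroup_of_forall`), `v` the transport of `v₀` to `H¹(A(ℂ); ℂ)`.
4. (§4, THE SOCKET) For `u ∈ S(A)(h)(ℂ)` with `det(u|_W) = 1` (`h ∈ B¹(A) ⊗ ℂ`, `Q_h` non-degenerate, `φ^*` a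
   `d`-similitude of `Q_h`, as displayed by the census files): the operator `v` of §3 with `v|_W = u|_W` lies in
   `Hg|_{H¹} ≤ S(A)(h)` (`Milne1999.hodgeGroupOne_le_unitaryCentralizerGroup`), so `w = v⁻¹u ∈ S(A)(h)` is the identity
   on `W`, hence on `W̄` (`W`, `W̄` are `Q_h`-isotropic and `Q_h` is non-degenerate), so `u = v`. No comparison between
   `Q_h` and `ψ` is needed. §5: van Geemen's `HasHodgeGroupSU A φ n d h` for such `h` (`⊆` is the tree's
   `hodgeGroupOne_le_weilSpecialUnitaryGroup`).

IN PRINT? The conclusion «`Hg = SU_H` for every Weil-type abelian variety with `End⁰ = K` and `Lie Hg ⊇ 𝔰𝔲`» is the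
standard Lie-algebra-to-group passage for connected algebraic groups (Deligne I §3: `Hg` connected; Goodman–Wallach
Thm. 2.2.7); on the tree's Tannaka-free carrier it is proved here by unipotent generation, as in the tree's
`RibetType*PowersHodgeClasses` files (there with the FFT, here with the group itself). RECORD-class, not a new result.
presearch: «Hodge group Weil type SU(n,n) Lie algebra generated unipotent» → [corpus:paper:arxiv-alg-geom_9709030 p18–19]
(Gordon §6, proof of Thm. 6.3.3: `MT(A, ℂ) → GL(W′)` surjective, "extend scalars to `ℂ`") gives the method; no statement
of the socket as such (queries: lit search --hybrid "Hodge group abelian variety Weil type special unitary group Lie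
algebra determines group"; galaxy "Weil type|special Mumford-Tate|SU(3,3)" — method only).

## References

* [Deligne1982HodgeCycles] P. Deligne, Hodge cycles on abelian varieties, LNM 900 (1982), I §3 Prop. 3.4, 3.6, §4.
* [GoodmanWallachGTM255] R. Goodman, N. R. Wallach, GTM 255 (2009), Lemma 2.2.1, Thm. 2.2.2, Thm. 2.2.7 (2), §4.1.1, §5.3.1.
* [vanGeemen1994HodgeAV] B. van Geemen, LNM 1594 (1994), 4.9, 6.4–6.6, 6.9, Lemma 6.10, Thm. 6.11, Thm. 6.12.
* [Milne1999LefschetzClasses] J. S. Milne, Duke Math. J. 96 (1999), §1 pp. 643–644, §4 p. 659, Thm. 4.4.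
* [MoonenZarhin1999LowDim] B. Moonen, Yu. Zarhin, Math. Ann. 315 (1999), §2 (2.3), §3 (3.1).
* [MoonenZarhin1998WeilClasses] B. Moonen, Yu. Zarhin, J. reine angew. Math. 496 (1998), §1.
* [Gordon1997] B. B. Gordon, A survey of the Hodge conjecture for abelian varieties, arXiv:alg-geom/9709030, §6 pp. 18–19.
-/

noncomputable section

open scoped TensorProduct
open scoped Matrix
open CategoryTheory Module

namespace Literature.AlgebraicGeometry.HodgeTheory

open Literature.AlgebraicTopology.SingularHomology
open Literature.AlgebraicGeometry.Motives (IsSmoothProjective AbelianVariety bettiCohomology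
  ofRatClassBaseChange ofRatClassBaseChange_tmul HodgeTensorFacts hodgeTensorFacts_holds)
open Literature.AlgebraicGeometry.Motives.HodgeStructure
open Literature.RepresentationTheory.GeneralLinear
open Literature.RepresentationTheory.ClassicalInvariants
open Literature.NumberTheory.DiophantineGeometry
open Literature.AlgebraicGeometry.VanGeemen1994 (pullbackOne hodgeGroupOne mem_hodgeGroupOne_iff hodgeClassSpan
  detOnEigenspace weilSpecialUnitaryGroup HasHodgeGroupSU)
open Literature.AlgebraicGeometry.Milne1999

/-! ### §0 Linear algebra: the basis of an eigenspace cut out of a block basis; matrices of restrictions -/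

section LinearAlgebra

variable {K V : Type*} [Field K] [AddCommGroup V] [Module K V] {k : ℕ}

/-- The two elements of `Fin 2`. [folklore] -/
private theorem fin2_eq_zero_or_one (r : Fin 2) : r = 0 ∨ r = 1 := by
  fin_cases r <;> simp

/-- **A block of a block basis is a basis of its eigenspace.** If `cb` is a basis indexed by `Fin 2 × Fin k` on whose
blocks `f` acts by scalars `ε t'`, and the block `t` is the only one with scalar `μ`, then the block `t` is a basis of
the eigenspace `ker(f − μ)`: there is a basis `bW` of `ker(f − μ)` with `bW ℓ = cb (t, ℓ)`. (The eigenspaces `W`, `W̄` of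
`φ_ℂ` on `V_ℂ = W ⊕ W̄` in adapted letters.) [cite: vanGeemen1994HodgeAV, Lemma 6.10 (proof)] -/
theorem exists_basis_eigenspace_of_block (cb : Module.Basis (Fin 2 × Fin k) K V) {f : Module.End K V}
    {ε : Fin 2 → K} (hf : ∀ t ℓ, f (cb (t, ℓ)) = ε t • cb (t, ℓ)) (t : Fin 2) {μ : K} (ht : ε t = μ)
    (hne : ∀ t', t' ≠ t → ε t' ≠ μ) :
    ∃ bW : Module.Basis (Fin k) K (Module.End.eigenspace f μ), ∀ ℓ, (bW ℓ : V) = cb (t, ℓ) := by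
  classical
  have hmem : ∀ ℓ, cb (t, ℓ) ∈ Module.End.eigenspace f μ := fun ℓ =>
    Module.End.mem_eigenspace_iff.2 (by rw [hf, ht])
  set v : Fin k → Module.End.eigenspace f μ := fun ℓ => ⟨cb (t, ℓ), hmem ℓ⟩ with hv
  have hli : LinearIndependent K v := by
    refine LinearIndependent.of_comp (Module.End.eigenspace f μ).subtype ?_
    have h : (Module.End.eigenspace f μ).subtype ∘ v = cb ∘ fun ℓ => (t, ℓ) := rfl
    rw [h]
    exact cb.linearIndependent.comp _ fun _ _ h' => (Prod.mk.inj h').2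
  have hsp : ⊤ ≤ Submodule.span K (Set.range v) := by
    rintro ⟨w, hw⟩ -
    -- the coordinates of `w` off the block `t` vanish
    set c := cb.repr w with hc
    have hφw : f w = μ • w := Module.End.mem_eigenspace_iff.1 hw
    have hsum : w = ∑ tl : Fin 2 × Fin k, c tl • cb tl := (cb.sum_repr w).symm
    have h1 : f w = ∑ tl : Fin 2 × Fin k, (c tl * ε tl.1) • cb tl := by
      conv_lhs => rw [hsum]
      rw [map_sum]
      exact Finset.sum_congr rfl fun tl _ => by rw [map_smul, hf, smul_smul]
    have h2 : f w = ∑ tl : Fin 2 × Fin k, (μ * c tl) • cb tl := by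
      rw [hφw, hsum, Finset.smul_sum]
      exact Finset.sum_congr rfl fun tl _ => by rw [smul_smul]
    have hcoef : ∀ tl : Fin 2 × Fin k, c tl * ε tl.1 = μ * c tl := fun tl => by
      have e1 := congrArg (fun x => cb.repr x tl) h1
      have e2 := congrArg (fun x => cb.repr x tl) h2
      simp only [cb.repr_sum_self] at e1 e2
      rw [← e1, ← e2]
    have hoff : ∀ tl : Fin 2 × Fin k, tl.1 ≠ t → c tl = 0 := fun tl htl => by
      have h := hcoef tl
      rw [mul_comm] at h
      by_contra hc0
      exact hne tl.1 htl (mul_right_cancel₀ hc0 h)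
    have hw' : w = ∑ ℓ, c (t, ℓ) • cb (t, ℓ) := by
      rw [hsum, Fintype.sum_prod_type]
      rw [Finset.sum_eq_single t]
      · intro t' _ ht'
        exact Finset.sum_eq_zero fun ℓ _ => by rw [hoff (t', ℓ) ht', zero_smul]
      · intro h; exact absurd (Finset.mem_univ t) h
    have hmemspan : (⟨w, hw⟩ : Module.End.eigenspace f μ) = ∑ ℓ, c (t, ℓ) • v ℓ := by
      apply Subtype.ext
      rw [Submodule.coe_sum]
      change w = _
      rw [hw']
      exact Finset.sum_congr rfl fun ℓ _ => rfl
    rw [hmemspan]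
    exact Submodule.sum_mem _ fun ℓ _ => Submodule.smul_mem _ _ (Submodule.subset_span ⟨ℓ, rfl⟩)
  exact ⟨Module.Basis.mk hli hsp, fun ℓ => by rw [Module.Basis.mk_apply]⟩

/-- **The matrix of a restriction in a block basis.** If `Y` preserves a submodule `W` with basis `bW`, `bW ℓ = e ℓ`, and
`Y (e ℓ) = ∑_r X_{r ℓ} e r`, then the matrix of `Y|_W` in `bW` is `X`; hence `tr(Y|_W) = tr X` and `det(Y|_W) = det X`.
[cite: GoodmanWallachGTM255, §4.1.1] -/
theorem toMatrix_restrict_eq_of_apply_eq_sum {W : Submodule K V} (bW : Module.Basis (Fin k) K W) {e : Fin k → V}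
    (hbW : ∀ ℓ, (bW ℓ : V) = e ℓ) {Y : Module.End K V} (hYW : ∀ x ∈ W, Y x ∈ W) (X : Matrix (Fin k) (Fin k) K)
    (hY : ∀ ℓ, Y (e ℓ) = ∑ r, X r ℓ • e r) :
    LinearMap.toMatrix bW bW (Y.restrict hYW) = X := by
  ext r ℓ
  have h : (Y.restrict hYW) (bW ℓ) = ∑ r', X r' ℓ • bW r' := by
    apply Subtype.ext
    rw [LinearMap.coe_restrict_apply, hbW, hY, Submodule.coe_sum]
    exact Finset.sum_congr rfl fun r' _ => by rw [Submodule.coe_smul, hbW]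
  rw [LinearMap.toMatrix_apply, h, bW.repr_sum_self]

/-- `tr(Y|_W) = tr X` in the situation of `toMatrix_restrict_eq_of_apply_eq_sum`. [cite: GoodmanWallachGTM255, §4.1.1] -/
theorem trace_restrict_eq_of_apply_eq_sum {W : Submodule K V} (bW : Module.Basis (Fin k) K W) {e : Fin k → V}
    (hbW : ∀ ℓ, (bW ℓ : V) = e ℓ) {Y : Module.End K V} (hYW : ∀ x ∈ W, Y x ∈ W) (X : Matrix (Fin k) (Fin k) K)
    (hY : ∀ ℓ, Y (e ℓ) = ∑ r, X r ℓ • e r) :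
    LinearMap.trace K W (Y.restrict hYW) = X.trace := by
  rw [LinearMap.trace_eq_matrix_trace K bW, toMatrix_restrict_eq_of_apply_eq_sum bW hbW hYW X hY]

/-- `det(Y|_W) = det X` in the situation of `toMatrix_restrict_eq_of_apply_eq_sum`. [cite: GoodmanWallachGTM255, §4.1.1] -/
theorem det_restrict_eq_of_apply_eq_sum {W : Submodule K V} (bW : Module.Basis (Fin k) K W) {e : Fin k → V}
    (hbW : ∀ ℓ, (bW ℓ : V) = e ℓ) {Y : Module.End K V} (hYW : ∀ x ∈ W, Y x ∈ W) (X : Matrix (Fin k) (Fin k) K)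
    (hY : ∀ ℓ, Y (e ℓ) = ∑ r, X r ℓ • e r) :
    LinearMap.det (Y.restrict hYW) = X.det := by
  rw [← LinearMap.det_toMatrix bW, toMatrix_restrict_eq_of_apply_eq_sum bW hbW hYW X hY]

/-- Bilinear expansion on two finite combinations: `B(∑ aᵣ eᵣ, ∑ bₛ fₛ) = ∑ᵣ ∑ₛ aᵣ bₛ B(eᵣ, fₛ)`. [folklore] -/
private theorem bilin_apply_sum_smul_sum_smul {W : Type*} [AddCommGroup W] [Module K W] {ι : Type*} [Fintype ι]
    (B : V →ₗ[K] V →ₗ[K] W) (a b : ι → K) (e f : ι → V) :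
    B (∑ r, a r • e r) (∑ s, b s • f s) = ∑ r, ∑ s, (a r * b s) • B (e r) (f s) := by
  rw [LinearMap.map_sum₂]
  refine Finset.sum_congr rfl fun r _ => ?_
  rw [LinearMap.map_smul₂, map_sum, Finset.smul_sum]
  refine Finset.sum_congr rfl fun s' _ => ?_
  rw [map_smul, smul_smul]

end LinearAlgebra

/-! ### §1 INVARIANCE: under «`Lie Hg ⊗ ℂ ⊇ 𝔰𝔲_K`» the Hodge classes on varieties with slots over `A` are killed by the traceless typed differentials -/

section Invariance

variable {A B : AbelianVariety ℂ} {n : ℕ} {g : Fin n → (B ⟶ A)}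

open scoped Classical in
/-- **THE INVARIANCE THEOREM under the displayed Lie hypothesis `hSU`** («every `φ_ℂ`-commuting `ψ_ℂ`-skew operator with
trace `0` on `W = ker(φ_ℂ − μ)` lies in `Lie Hg(H¹A) ⊗ ℂ`», the conclusion of brick B4′ of the (3|3) Weil square) — the
tree's `AVSlots.exists_unitaryInvariant_coeff_threeCoprime` with `hSU` in place of THEOREM L⁗ and TRACELESS `X`: every
rational `(p,p)`-class on an abelian variety `B` with slots `g` over `A` is `∑_w a(w)·(g e, g f)_w` in adapted
`ψ_ℂ`-dual letters `(e_ℓ, f_ℓ)` for a coefficient function `a` on slot-and-type words whose slices are killed by the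
typed differential (`X` on the `W`-letters, `−Xᵀ` on the `W̄`-letters) of EVERY `X ∈ 𝔰𝔩_{n₀}(ℂ)`. The operator
`Y_X = X ⊕ (−Xᵀ)` commutes with `φ_ℂ`, is `ψ_ℂ`-skew (duality of the letters) and has `tr(Y_X|_W) = tr X = 0`, so
`Y_X ∈ Lie Hg ⊗ ℂ` by `hSU`; Theorem L-Hg (`wordDerAt_eq_zero_of_mem_hodgeLieC`, Deligne's rigidity) kills the rational
coefficient tensor. [cite: Deligne1982HodgeCycles, I §3 Prop. 3.4 and its proof] [cite: MoonenZarhin1999LowDim, §3 (3.1)]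
[cite: Gordon1997, §6 (proof of Thm. 6.3.3, pp. 18–19)] -/
theorem AVSlots.exists_slInvariant_coeff_of_hodgeLieC [HodgeTensorFacts.{0, 0}] (hg : AVSlots A B g)
    (hHD : exists_isReal_hodgeModel) (hI : hodgePQ_independent_of_hodgeModel)
    (ψ : (BettiUniverse.hodge hHD (AbelianVariety.isSmoothProjective_holds (A := A)) 1).Polarization)
    {φ : Module.End ℚ (bettiCohomology A.X 1)}
    (hφE : φ ∈ (BettiUniverse.hodge hHD (AbelianVariety.isSmoothProjective_holds (A := A)) 1).endAlg)
    {d : ℚ} (hd : 0 < d) (hφ2 : φ * φ = -(d • 1))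
    (hE : ∀ a ∈ (BettiUniverse.hodge hHD (AbelianVariety.isSmoothProjective_holds (A := A)) 1).endAlg,
      ∃ x y : ℚ, a = x • 1 + y • φ)
    {μ : ℂ} (hμ : μ ^ 2 = -(d : ℂ))
    (hSU : ∀ (Y : Module.End ℂ (ℂ ⊗[ℚ] bettiCohomology A.X 1)) (hYφ : Y * φ.baseChange ℂ = φ.baseChange ℂ * Y),
      (∀ x y, ψ.form.baseChange ℂ (Y x) y + ψ.form.baseChange ℂ x (Y y) = 0) →
      LinearMap.trace ℂ _ (Y.restrict fun x (hx : x ∈ Module.End.eigenspace (φ.baseChange ℂ) μ) =>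
        UnitaryTheta.apply_mem_eigenspace_of_commute hYφ hx) = 0 →
      Y ∈ (BettiUniverse.hodge hHD (AbelianVariety.isSmoothProjective_holds (A := A)) 1).hodgeLieC)
    {n₀ : ℕ} (cb : Module.Basis (Fin 2 × Fin n₀) ℂ (ℂ ⊗[ℚ] bettiCohomology A.X 1)) (κ : Fin n₀ → Fin 2)
    (hcbW : ∀ ℓ, cb (0, ℓ) ∈ Module.End.eigenspace (φ.baseChange ℂ) μ)
    (hcbW' : ∀ ℓ, cb (1, ℓ) ∈ Module.End.eigenspace (φ.baseChange ℂ) (-μ))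
    (hcb0 : ∀ ℓ, κ ℓ = 0 →
      cb (0, ℓ) ∈ (BettiUniverse.hodge hHD (AbelianVariety.isSmoothProjective_holds (A := A)) 1).piece 1 0 ∧
      cb (1, ℓ) ∈ (BettiUniverse.hodge hHD (AbelianVariety.isSmoothProjective_holds (A := A)) 1).piece 0 1)
    (hcb1 : ∀ ℓ, κ ℓ = 1 →
      cb (0, ℓ) ∈ (BettiUniverse.hodge hHD (AbelianVariety.isSmoothProjective_holds (A := A)) 1).piece 0 1 ∧
      cb (1, ℓ) ∈ (BettiUniverse.hodge hHD (AbelianVariety.isSmoothProjective_holds (A := A)) 1).piece 1 0)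
    (hdual : ∀ i j, ψ.form.baseChange ℂ (cb (0, i)) (cb (1, j)) = if i = j then 1 else 0)
    {p : ℕ} (hp : 0 < p) {c : complexBetti B.X (2 * p)} (hcQ : IsRationalClass c)
    (hc : IsOfHodgeType B.dim B.X (2 * p) p p c) :
    ∃ a : (Fin (2 * p) → (Fin n × Fin 2) × Fin n₀) → ℂ,
      wordEval (cupPowOneAlt ℂ (Motives.ComplexPoints B.X) (2 * p))
        (fun x : (Fin n × Fin 2) × Fin n₀ => avLetters g (fun tl : Fin 2 × Fin n₀ =>
          ofRatClassBaseChange (Motives.ComplexPoints A.X) 1 (cb tl)) (x.1.1, (x.1.2, x.2))) a = c ∧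
      ∀ (U : Fin (2 * p) → Fin n × Fin 2) (X : Matrix (Fin n₀) (Fin n₀) ℂ), X.trace = 0 →
        wordDerAt ℂ (fun t => if (U t).2 = 0 then X else -Xᵀ) (wordSlice a U) = 0 := by
  classical
  -- the setting
  have hX : IsSmoothProjective A.dim A.X := AbelianVariety.isSmoothProjective_holds
  haveI : Module.Finite ℚ (bettiCohomology A.X 1) := finite_bettiCohomology_one A
  have hn1 : (((1 : ℕ) : ℤ)) = 1 := Nat.cast_one
  have heff := BettiUniverse.hodge_isEffective hHD hX 1
  obtain ⟨hμ0, -⟩ := UnitaryTheta.conj_eq_neg_of_sq hd hμ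
  set F := cupPowOneAlt ℂ (Motives.ComplexPoints B.X) (2 * p) with hFdef
  have hFinj : Function.Injective (exteriorPower.alternatingMapLinearEquiv F) :=
    injective_alternatingMapLinearEquiv_cupPowOneAlt B (2 * p)
  -- bases: the adapted basis `cbσ` and the rational basis `eC`, both indexed by `Fin M`
  set eQ := Module.finBasis ℚ (bettiCohomology A.X 1) with heQ
  set eC : Module.Basis (Fin (Module.finrank ℚ (bettiCohomology A.X 1))) ℂ
    (ℂ ⊗[ℚ] bettiCohomology A.X 1) := Algebra.TensorProduct.basis ℂ eQ with heC
  set φι : Fin (Module.finrank ℚ (bettiCohomology A.X 1)) ≃ Fin 2 × Fin n₀ := eC.indexEquiv cb with hφι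
  set cbσ : Module.Basis (Fin (Module.finrank ℚ (bettiCohomology A.X 1))) ℂ
    (ℂ ⊗[ℚ] bettiCohomology A.X 1) := cb.reindex φι.symm with hcbσdef
  have hcbσ : ∀ m, cbσ m = cb (φι m) := fun m => by
    rw [hcbσdef, Module.Basis.reindex_apply, Equiv.symm_symm]
  -- kinds of the adapted letters
  set κ2 : Fin 2 × Fin n₀ → Fin 2 := fun tl => if tl.1 = 0 then κ tl.2 else (if κ tl.2 = 0 then 1 else 0)
    with hκ2
  have hkind : ∀ tl : Fin 2 × Fin n₀,
      (κ2 tl = 0 → cb tl ∈ (BettiUniverse.hodge hHD (AbelianVariety.isSmoothProjective_holds (A := A)) 1).piece 1 0) ∧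
      (κ2 tl = 1 → cb tl ∈ (BettiUniverse.hodge hHD (AbelianVariety.isSmoothProjective_holds (A := A)) 1).piece 0 1) := by
    rintro ⟨t, ℓ⟩
    rcases fin2_eq_zero_or_one t with rfl | rfl <;> rcases fin2_eq_zero_or_one (κ ℓ) with h | h
    · have hk : κ2 (0, ℓ) = 0 := by simp [hκ2, h]
      rw [hk]
      exact ⟨fun _ => (hcb0 ℓ h).1, fun h' => absurd h' (by decide)⟩
    · have hk : κ2 (0, ℓ) = 1 := by simp [hκ2, h]
      rw [hk]
      exact ⟨fun h' => absurd h' (by decide), fun _ => (hcb1 ℓ h).1⟩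
    · have hk : κ2 (1, ℓ) = 1 := by simp [hκ2, h]
      rw [hk]
      exact ⟨fun h' => absurd h' (by decide), fun _ => (hcb0 ℓ h).2⟩
    · have hk : κ2 (1, ℓ) = 0 := by simp [hκ2, h]
      rw [hk]
      exact ⟨fun _ => (hcb1 ℓ h).2, fun h' => absurd h' (by decide)⟩
  set κ' : Fin (Module.finrank ℚ (bettiCohomology A.X 1)) → Fin 2 := fun m => κ2 (φι m) with hκ'
  -- letters
  set ρ := ofRatClassBaseChangeEquiv hX 1 with hρ
  set v : Module.Basis _ ℂ (complexBetti A.X 1) := cbσ.map ρ with hv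
  set eL : Module.Basis _ ℂ (complexBetti A.X 1) := eC.map ρ with heL
  have heLQ : ∀ i, IsRationalClass (eL i) := fun i => by
    rw [heL, Module.Basis.map_apply, heC, Algebra.TensorProduct.basis_apply, hρ,
      ofRatClassBaseChangeEquiv_apply, ofRatClassBaseChange_tmul, one_smul]
    exact isRationalClass_ofRatClass _
  have hv_apply : ∀ m, v m = ofRatClassBaseChange (Motives.ComplexPoints A.X) 1 (cb (φι m)) := fun m => by
    rw [hv, Module.Basis.map_apply, hcbσ, hρ, ofRatClassBaseChangeEquiv_apply]
  have hv0 : ∀ m, κ' m = 0 → IsOfHodgeType A.dim A.X 1 1 0 (v m) := by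
    intro m hm
    rw [hv_apply, ← BettiUniverse.mem_hodge_piece_iff hHD hI hX (k := 1) (p := 1) (q := 0) rfl]
    exact (hkind (φι m)).1 hm
  have hv1 : ∀ m, κ' m = 1 → IsOfHodgeType A.dim A.X 1 0 1 (v m) := by
    intro m hm
    rw [hv_apply, ← BettiUniverse.mem_hodge_piece_iff hHD hI hX (k := 1) (p := 0) (q := 1) rfl]
    exact (hkind (φι m)).2 hm
  -- (α) an antisymmetric kind-balanced coefficient function in the adapted letters
  obtain ⟨ax, hax_bal, hax_anti, hcax⟩ := hg.exists_antisymm_kindBalanced_wordEval_eq v κ' hv0 hv1 hp hc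
  -- the change of letters to the rational letters
  set G : Matrix _ _ ℂ := eC.toMatrix cbσ with hG
  set G' : Matrix _ _ ℂ := cbσ.toMatrix eC with hG'
  have hG'G : G' * G = 1 := cbσ.toMatrix_mul_toMatrix_flip eC
  have hve : ∀ m, v m = ∑ i, G i m • eL i := fun m => by
    simp only [hv, heL, Module.Basis.map_apply, ← map_smul, ← map_sum]
    congr 1
    exact (eC.sum_toMatrix_smul_self (v := ⇑cbσ) (j := m)).symm
  have hletters : ∀ j m, avLetters g v (j, m) = ∑ i, G i m • avLetters g eL (j, i) :=
    avLetters_baseChange g G hve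
  set aE := colourChangeAt (fun _ : Fin n => G) ax with haE
  have haE_anti : IsAntisymm aE := hax_anti.colourChangeAt _
  have hcaE : wordEval F (avLetters g eL) aE = c := by
    rw [haE, ← wordEval_eq_wordEval_colourChangeAt F (fun _ : Fin n => G) hletters ax, hcax]
  -- rationality of `aE`
  obtain ⟨q, hq⟩ := hg.exists_rat_wordEval_eq eL heLQ hcQ
  obtain ⟨q', -, haEq⟩ := haE_anti.exists_eq_algebraMap_of_wordEval_eq hFinj (hg.letterBasis eL)
    (q := q) (by rw [AVSlots.coe_letterBasis, hcaE, hFdef, hq])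
  have hslice_e : ∀ u, wordSlice aE u = wordRepAt ℂ (fun _ : Fin (2 * p) => G) (wordSlice ax u) :=
    fun u => wordSlice_colourChangeAt (fun _ : Fin n => G) ax u
  -- the Hodge operator `Θ`: `diag(±1)` in the adapted letters
  obtain ⟨Θ, hΘ⟩ := exists_hodgeTheta (BettiUniverse.hodge hHD (AbelianVariety.isSmoothProjective_holds (A := A)) 1)
  obtain ⟨-, -, hΘ10, hΘ01, -⟩ :=
    UnitaryTheta.theta_facts (BettiUniverse.hodge hHD (AbelianVariety.isSmoothProjective_holds (A := A)) 1) hn1 heff hΘ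
  have hΘb : ∀ m, Θ (cbσ m) = (if κ' m = 0 then (1 : ℂ) else -1) • cbσ m := by
    intro m
    rw [hcbσ]
    rcases fin2_eq_zero_or_one (κ' m) with h0 | h1'
    · rw [h0, if_pos rfl, one_smul]
      exact hΘ10 _ ((hkind (φι m)).1 h0)
    · rw [h1', if_neg one_ne_zero, neg_one_smul]
      exact hΘ01 _ ((hkind (φι m)).2 h1')
  have hΘcb : LinearMap.toMatrix cbσ cbσ Θ = kindDiag κ' := by
    ext i m
    rw [LinearMap.toMatrix_apply, hΘb, map_smul, Module.Basis.repr_self, Finsupp.smul_apply,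
      Finsupp.single_apply, kindDiag, Matrix.diagonal_apply, smul_eq_mul, mul_ite, mul_one, mul_zero]
    by_cases him : i = m
    · subst him; rw [if_pos rfl]
    · rw [if_neg (Ne.symm him), if_neg him]
  have hJG : LinearMap.toMatrix eC eC Θ * G = G * kindDiag κ' := by
    rw [← hΘcb, hG, linearMap_toMatrix_mul_basis_toMatrix, basis_toMatrix_mul_linearMap_toMatrix]
  have hΘq : ∀ u : Fin (2 * p) → Fin n, wordDerAt ℂ (fun _ : Fin (2 * p) => LinearMap.toMatrix eC eC Θ)
      (wordSlice (fun w => algebraMap ℚ ℂ (q' w)) u) = 0 := by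
    intro u
    rw [← haEq, hslice_e]
    refine wordDerAt_wordRepAt_eq_zero_of_mul_eq ℂ (fun _ : Fin (2 * p) => G) (fun _ => hJG) ?_
    rw [wordDerAt_const]
    exact wordDer_kindDiag_wordSlice_eq_zero κ' hax_bal u
  -- structure of the adapted basis for `ψ_ℂ` and `φ_ℂ`
  set ψC := ψ.form.baseChange ℂ with hψC
  have hφskewC : ∀ x y, ψC (φ.baseChange ℂ x) y + ψC x (φ.baseChange ℂ y) = 0 := by
    rcases subsingleton_or_nontrivial (bettiCohomology A.X 1) with hV | hV
    · haveI : Subsingleton (ℂ ⊗[ℚ] bettiCohomology A.X 1) := by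
        refine ⟨fun x y => ?_⟩
        have h : ∀ z : ℂ ⊗[ℚ] bettiCohomology A.X 1, z = 0 := fun z => by
          induction z using TensorProduct.induction_on with
          | zero => rfl
          | tmul c' v' => rw [Subsingleton.elim v' 0, TensorProduct.tmul_zero]
          | add a' b' ha hb => rw [ha, hb, add_zero]
        rw [h x, h y]
      intro x y
      rw [Subsingleton.elim x 0, Subsingleton.elim (φ.baseChange ℂ 0) 0, map_zero, LinearMap.zero_apply,
        LinearMap.zero_apply, add_zero]
    · exact ThetaSubalgebra.formBaseChange_add_eq_zero_of_skew ψ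
        (UnitaryTheta.form_apply_add_form_apply_eq_zero _ ψ hφE hd hφ2 hE)
  have hiso0 : ∀ i j, ψC (cb (0, i)) (cb (0, j)) = 0 := fun i j =>
    UnitaryTheta.form_eq_zero_of_mem_eigenspace hφskewC hμ0 (hcbW i) (hcbW j)
  have hiso1 : ∀ i j, ψC (cb (1, i)) (cb (1, j)) = 0 := fun i j =>
    UnitaryTheta.form_eq_zero_of_mem_eigenspace hφskewC (neg_ne_zero.2 hμ0) (hcbW' i) (hcbW' j)
  have hswap10 : ∀ i j, ψC (cb (1, i)) (cb (0, j)) = -(if j = i then 1 else 0) := fun i j => by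
    rw [hψC, ψ.form_baseChange_swap, show (((1 : ℕ) : ℤ)).negOnePow = -1 from Int.negOnePow_one, ← hψC, hdual]
    split_ifs <;> simp
  have hφcb : ∀ t ℓ, φ.baseChange ℂ (cb (t, ℓ)) = (if t = 0 then μ else -μ) • cb (t, ℓ) := by
    intro t ℓ
    rcases fin2_eq_zero_or_one t with rfl | rfl
    · rw [if_pos rfl]; exact Module.End.mem_eigenspace_iff.1 (hcbW ℓ)
    · rw [if_neg one_ne_zero]; exact Module.End.mem_eigenspace_iff.1 (hcbW' ℓ)
  -- a basis of `W = ker(φ_ℂ − μ)` made of the letters `cb (0, ℓ)` (for the trace condition of `hSU`)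
  obtain ⟨bW, hbW⟩ := exists_basis_eigenspace_of_block cb (f := φ.baseChange ℂ)
    (ε := fun t => if t = 0 then μ else -μ) hφcb 0 (if_pos rfl) (fun t' ht' => by
      rcases fin2_eq_zero_or_one t' with rfl | rfl
      · exact absurd rfl ht'
      · rw [if_neg one_ne_zero]
        intro h
        exact hμ0 (by
          have h2 : (2 : ℂ) * μ = 0 := by rw [two_mul]; nth_rw 1 [← h]; exact neg_add_cancel μ
          exact (mul_eq_zero.1 h2).resolve_left two_ne_zero))
  -- the invariance of every slice under the TRACELESS typed differentials, via `hSU` and THEOREM L-Hg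
  have key : ∀ (X : Matrix (Fin n₀) (Fin n₀) ℂ), X.trace = 0 → ∀ (u : Fin (2 * p) → Fin n),
      wordDerAt ℂ (fun _ : Fin (2 * p) => blockLiftGen φι (fun t : Fin 2 => if t = 0 then X else -Xᵀ))
        (wordSlice ax u) = 0 := by
    intro X hXtr u
    set Nf : Fin 2 → Matrix (Fin n₀) (Fin n₀) ℂ := fun t => if t = 0 then X else -Xᵀ with hNf
    have hNf0 : Nf 0 = X := if_pos rfl
    have hNf1 : Nf 1 = -Xᵀ := if_neg one_ne_zero
    set Y := Matrix.toLin cbσ cbσ (blockLiftGen φι Nf) with hYdef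
    have hYcb : ∀ t ℓ, Y (cb (t, ℓ)) = ∑ r, Nf t r ℓ • cb (t, r) :=
      fun t ℓ => toLin_blockLiftGen_apply φι cbσ (⇑cb) hcbσ Nf t ℓ
    have hYφ : Y * φ.baseChange ℂ = φ.baseChange ℂ * Y := by
      refine cb.ext fun tl => ?_
      obtain ⟨t, ℓ⟩ := tl
      rw [Module.End.mul_apply, Module.End.mul_apply, hφcb, map_smul, hYcb, map_sum, Finset.smul_sum]
      exact Finset.sum_congr rfl fun r _ => by rw [map_smul, hφcb, smul_comm]
    have hYskew : ∀ x y, ψC (Y x) y + ψC x (Y y) = 0 := by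
      have hB : ψC ∘ₗ Y + ψC.compl₂ Y = 0 := by
        refine LinearMap.BilinForm.ext_basis cb fun tk tl => ?_
        obtain ⟨t, k⟩ := tk
        obtain ⟨t', ℓ⟩ := tl
        rw [LinearMap.add_apply, LinearMap.add_apply, LinearMap.comp_apply, LinearMap.compl₂_apply,
          LinearMap.zero_apply, LinearMap.zero_apply, hYcb, hYcb, map_sum, LinearMap.sum_apply, map_sum]
        simp only [map_smul, LinearMap.smul_apply, smul_eq_mul]
        rcases fin2_eq_zero_or_one t with rfl | rfl <;> rcases fin2_eq_zero_or_one t' with rfl | rfl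
        · simp [hiso0]
        · simp [hNf0, hNf1, hdual, Matrix.neg_apply, Matrix.transpose_apply, mul_ite, Finset.sum_ite_eq,
            Finset.sum_ite_eq']
        · simp [hNf0, hNf1, hswap10, Matrix.neg_apply, Matrix.transpose_apply, mul_ite, Finset.sum_ite_eq,
            Finset.sum_ite_eq']
        · simp [hiso1]
      intro x y
      have h := LinearMap.congr_fun (LinearMap.congr_fun hB x) y
      simpa only [LinearMap.add_apply, LinearMap.comp_apply, LinearMap.compl₂_apply, LinearMap.zero_apply]
        using h
    -- the trace of `Y` on `W` is `tr X = 0`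
    have hYtr : LinearMap.trace ℂ _ (Y.restrict fun x (hx : x ∈ Module.End.eigenspace (φ.baseChange ℂ) μ) =>
        UnitaryTheta.apply_mem_eigenspace_of_commute hYφ hx) = 0 := by
      rw [trace_restrict_eq_of_apply_eq_sum bW hbW _ X (fun ℓ => by rw [hYcb, hNf0]), hXtr]
    have hYC := hSU Y hYφ hYskew hYtr
    have hL := wordDerAt_eq_zero_of_mem_hodgeLieC (BettiUniverse.hodge hHD (AbelianVariety.isSmoothProjective_holds (A := A)) 1) ψ eQ q' hΘ hΘq hYC u
    rw [← haEq, hslice_e] at hL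
    have hYG : ∀ _t : Fin (2 * p), LinearMap.toMatrix eC eC Y * G = G * LinearMap.toMatrix cbσ cbσ Y :=
      fun _ => by rw [hG, linearMap_toMatrix_mul_basis_toMatrix, basis_toMatrix_mul_linearMap_toMatrix]
    have hblk : LinearMap.toMatrix cbσ cbσ Y = blockLiftGen φι Nf := by
      rw [hYdef, LinearMap.toMatrix_toLin]
    have h3 : wordRepAt ℂ (fun _ : Fin (2 * p) => G)
        (wordDerAt ℂ (fun _ : Fin (2 * p) => blockLiftGen φι Nf) (wordSlice ax u)) = 0 := by
      rw [← hblk, wordRepAt_wordDerAt_of_mul_eq ℂ (fun _ : Fin (2 * p) => G) hYG, hL]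
    exact wordRepAt_injective ℂ (g := fun _ : Fin (2 * p) => G) (g' := fun _ : Fin (2 * p) => G')
      (funext fun _ => hG'G) (by rw [h3, map_zero])
  -- the coefficient function, refined to slot-and-type colours
  refine ⟨placeRefineGen φι ax, ?_, fun U X hXtr => ?_⟩
  · rw [← hcax]
    have hx : (fun x : (Fin n × Fin 2) × Fin n₀ => avLetters g v (x.1.1, φι.symm (x.1.2, x.2))) =
        fun x => avLetters g (fun tl : Fin 2 × Fin n₀ =>
          ofRatClassBaseChange (Motives.ComplexPoints A.X) 1 (cb tl)) (x.1.1, (x.1.2, x.2)) := by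
      funext x
      rw [avLetters_apply, avLetters_apply, hv_apply, Equiv.apply_symm_apply]
    rw [← hx]
    exact wordEval_placeRefineGen F φι (avLetters g v) ax
  · exact wordDerAt_placeRefineGen_eq_zero φι (fun t : Fin 2 => if t = 0 then X else -Xᵀ) (key X hXtr) U

end Invariance

/-! ### §2 The exterior action of `v^{⊕(a+1)}` on the evaluation of a coefficient function is a slot-wise colour change -/

section Action

variable {A : AbelianVariety ℂ}

/-- **`⋀•(v^{⊕(a+1)})` acts on `∑_w a(w)·(g x)_w` through the coefficients.** For `v ∈ C(A)^×(ℂ)` acting on letters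
`x (t, ℓ) ∈ H¹(A(ℂ); ℂ)` blockwise, `v x_{t,ℓ} = ∑_r (G_t)_{r ℓ} x_{t,r}`, the automorphism `⋀ᵈ(v^{⊕(a+1)})` of
`Hᵈ(A^{a+1}(ℂ); ℂ)` (`Milne1999.diagPowExterior`) sends the evaluation of a coefficient function `a` on the slot letters
`pr_j^* x_{t,ℓ}` (colours `(j, t)`, letters `ℓ`) to the evaluation of the slot-wise colour change of `a` by `(j, t) ↦ G_t`
(`colourChangeAt`): `v^{⊕(a+1)} pr_j^* = pr_j^* v` (`diagPow_intertwine_right`), `⋀ᵈ` acts factorwise on products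
(`exteriorPullback_cupPowOne`), and products are multilinear (`wordEval_eq_wordEval_colourChangeAt`).
[cite: Milne1999LefschetzClasses, §1 p. 643 and §4 p. 659 (Def. 4.3)] [cite: GoodmanWallachGTM255, §4.1.1] -/
theorem diagPowExterior_wordEval_avLetters_eq_wordEval_colourChangeAt
    {v : complexBetti A.X 1 ≃ₗ[ℂ] complexBetti A.X 1} (hv : v ∈ centralizerGroup A) {T : Type*} [Fintype T]
    {k : ℕ} (x : T × Fin k → complexBetti A.X 1) (G : T → Matrix (Fin k) (Fin k) ℂ)
    (hvx : ∀ t ℓ, v (x (t, ℓ)) = ∑ r, G t r ℓ • x (t, r)) (a dd : ℕ)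
    (cf : (Fin dd → (Fin (a + 1) × T) × Fin k) → ℂ) :
    diagPowExterior A v a dd (wordEval (cupPowOneAlt ℂ (Motives.ComplexPoints (A.powSucc a).X) dd)
        (fun jr : (Fin (a + 1) × T) × Fin k => avLetters (avPowSlots A a) x (jr.1.1, (jr.1.2, jr.2))) cf) =
      wordEval (cupPowOneAlt ℂ (Motives.ComplexPoints (A.powSucc a).X) dd)
        (fun jr : (Fin (a + 1) × T) × Fin k => avLetters (avPowSlots A a) x (jr.1.1, (jr.1.2, jr.2)))
        (colourChangeAt (fun jt : Fin (a + 1) × T => G jt.2) cf) := by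
  set y' : (Fin (a + 1) × T) × Fin k → complexBetti (A.powSucc a).X 1 :=
    fun jr => avLetters (avPowSlots A a) x (jr.1.1, (jr.1.2, jr.2)) with hy'
  set y : (Fin (a + 1) × T) × Fin k → complexBetti (A.powSucc a).X 1 := fun jr => diagPow A v a (y' jr) with hy
  have hyy' : ∀ (jt : Fin (a + 1) × T) (ℓ : Fin k), y (jt, ℓ) = ∑ r, G jt.2 r ℓ • y' (jt, r) := by
    rintro ⟨j, t⟩ ℓ
    simp only [hy, hy', avLetters_apply]
    rw [diagPow_intertwine_right hv, hvx, map_sum]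
    exact Finset.sum_congr rfl fun r _ => by rw [map_smul]
  have hlhs : diagPowExterior A v a dd (wordEval (cupPowOneAlt ℂ (Motives.ComplexPoints (A.powSucc a).X) dd) y' cf) =
      wordEval (cupPowOneAlt ℂ (Motives.ComplexPoints (A.powSucc a).X) dd) y cf := by
    rw [wordEval_apply, wordEval_apply, map_sum]
    refine Finset.sum_congr rfl fun w _ => ?_
    rw [map_smul, cupPowOneAlt_apply, cupPowOneAlt_apply, diagPowExterior, exteriorPullbackEquiv_apply,
      exteriorPullback_cupPowOne]
    rfl
  rw [hlhs]
  exact wordEval_eq_wordEval_colourChangeAt _ (fun jt : Fin (a + 1) × T => G jt.2) hyy' cf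

/-- **A coefficient function fixed slice by slice is fixed**: if every slice of `a` is fixed by the Kronecker family
`G ∘ U`, then `colourChangeAt G a = a` (a coefficient function is the collection of its slices, `wordSlice_fst_snd`).
[cite: FultonYoungTableaux1997, §8.1] -/
theorem colourChangeAt_eq_self_of_forall_wordSlice {J : Type*} {N dd : ℕ} (G : J → Matrix (Fin N) (Fin N) ℂ)
    {cf : (Fin dd → J × Fin N) → ℂ}
    (h : ∀ U : Fin dd → J, wordRepAt ℂ (fun q => G (U q)) (wordSlice cf U) = wordSlice cf U) :
    colourChangeAt G cf = cf := by
  funext w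
  rw [← wordSlice_fst_snd (colourChangeAt G cf) w, ← wordSlice_fst_snd cf w, wordSlice_colourChangeAt, h]

end Action

/-! ### §2b `End⁰(A) = K`: an automorphism of `H¹(A(ℂ); ℂ)` commuting with `φ^*` commutes with every pull-back -/

section Centralizer

variable {A : AbelianVariety ℂ} {φ : A ⟶ A} {d : ℕ}

/-- **`End⁰(A) = K` ⟹ `{φ^*}' = C(A) ⊗ ℂ` on `GL(H¹(A(ℂ); ℂ))`**: for `φ ≫ φ = −d`, `d > 0`, `finrank_ℚ End⁰(A) = 2` and
`dim A > 0`, an automorphism `u` of `H¹(A(ℂ); ℂ)` commuting with `φ^*` commutes with every `ψ^*`, `ψ ∈ End(A)` (every `ψ^*` is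
a polynomial in `φ^*`, `pullbackOne_mem_adjoin_of_finrank_endAlgebra_eq_two`), i.e. `u ∈ Milne1999.centralizerGroup A`.
[cite: Milne1999LefschetzClasses, §1 pp. 642–644] [cite: vanGeemen1994HodgeAV, 6.9] -/
theorem mem_centralizerGroup_of_comm_pullbackOne_of_finrank_endAlgebra_eq_two (hd : 0 < d)
    (hφ : φ ≫ φ = -(d • 𝟙 A)) (hE2 : Module.finrank ℚ A.endAlgebra = 2) (hA : 0 < A.dim)
    {u : complexBetti A.X 1 ≃ₗ[ℂ] complexBetti A.X 1} (hu : ∀ z, u (pullbackOne A φ z) = pullbackOne A φ (u z)) :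
    u ∈ centralizerGroup A := by
  rw [mem_centralizerGroup_iff]
  intro w z
  have hw : pullbackOne A w ∈ Algebra.adjoin ℂ {pullbackOne A φ} :=
    pullbackOne_mem_adjoin_of_finrank_endAlgebra_eq_two hd hφ hE2 hA w
  have hle : Algebra.adjoin ℂ {pullbackOne A φ} ≤
      Subalgebra.centralizer ℂ {((u : complexBetti A.X 1 →ₗ[ℂ] complexBetti A.X 1) : Module.End ℂ (complexBetti A.X 1))} := by
    refine Algebra.adjoin_le ?_
    rintro _ rfl
    rw [SetLike.mem_coe, Subalgebra.mem_centralizer_iff]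
    rintro _ rfl
    refine LinearMap.ext fun x => ?_
    rw [Module.End.mul_apply, Module.End.mul_apply, LinearEquiv.coe_coe, hu]
  have hcomm := (Subalgebra.mem_centralizer_iff ℂ).1 (hle hw) _ rfl
  have h1 := LinearMap.congr_fun hcomm z
  rw [Module.End.mul_apply, Module.End.mul_apply, LinearEquiv.coe_coe] at h1
  exact h1

end Centralizer

/-! ### §3 «`Lie Hg ⊗ ℂ ⊇ 𝔰𝔲_K`» ⟹ every `φ_ℂ`-commuting `ψ_ℂ`-isometry of determinant one on `W` lies in `Hg(A)(ℂ)|_{H¹}` -/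

section SUleHg

variable {A : AbelianVariety ℂ} {φ : A ⟶ A} {n d : ℕ}

open scoped Classical in
/-- **`SU ⊆ Hg` FROM THE LIE STATEMENT.** Let `(A, φ)` be of Weil type `(n, d)` with `End⁰(A) = K` (`finrank_ℚ End⁰(A) = 2`),
`ψ` a polarization of `H¹(A(ℂ); ℚ)`, and assume the displayed Lie hypothesis `hSU` (brick B4′ of the (3|3) Weil square:
every `φ_ℂ`-commuting `ψ_ℂ`-skew operator with trace `0` on `W = ker(φ_ℂ − i√d)` lies in `Lie Hg(H¹A) ⊗ ℂ`). Then every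
automorphism `v₀` of `H¹(A(ℂ); ℚ) ⊗ ℂ` commuting with `φ_ℂ`, preserving `ψ_ℂ` and with `det(v₀|_W) = 1` — an element of
`SU_K(V, ψ)(ℂ) ≅ SL(W)` — transported to `H¹(A(ℂ); ℂ)`, lies in `Hg(A)(ℂ)|_{H¹} = hodgeGroupOne (dim A) A.X`: in adapted
`ψ_ℂ`-dual letters `v₀ = (M, (M⁻¹)ᵀ)` with `det M = 1`; the coefficient functions of the rational `(p,p)`-classes of every
power `A^{a+1}` are killed by the traceless typed differentials (§1), hence FIXED by the typed family of `M`
(`wordRepAt_mixedGrpFamily_eq_self_of_forall_trace_of_det_eq_one`: `SL` is generated by transvections — exponentials of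
square-zero traceless elements — and its determinant-one torus, Goodman–Wallach Lemma 2.2.1 / Thm. 2.2.2 / Thm. 2.2.7 (2)),
so `⋀•(v^{⊕(a+1)})` fixes those classes (§2) and `v ∈ Hg(A)(ℂ)|_{H¹}` (`exteriorPullbackEquiv_mem_hodgeGroup_of_forall`).
«`Hg` is connected with Lie algebra `𝔰𝔲`, hence `= SU`» on the tree's Tannaka-free carrier.
[cite: Deligne1982HodgeCycles, I §3 Prop. 3.4 and 3.6] [cite: GoodmanWallachGTM255, Thm. 2.2.2 and Thm. 2.2.7 (2)]
[cite: vanGeemen1994HodgeAV, Lemma 6.10 and Thm. 6.11] -/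
theorem IsWeilType.trans_mem_hodgeGroupOne_of_preserves_polarization_of_det_eq_one [HodgeTensorFacts.{0, 0}]
    (h : IsWeilType A φ n d) (hE2 : Module.finrank ℚ A.endAlgebra = 2)
    (ψ : (BettiUniverse.hodge exists_isReal_hodgeModel_holds (AbelianVariety.isSmoothProjective_holds (A := A)) 1).Polarization)
    (hSU : ∀ (Y : Module.End ℂ (ℂ ⊗[ℚ] bettiCohomology A.X 1))
      (hYφ : Y * ((bettiCohomology.map φ.hom.hom.hom 1).hom).baseChange ℂ =
        ((bettiCohomology.map φ.hom.hom.hom 1).hom).baseChange ℂ * Y),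
      (∀ x y, ψ.form.baseChange ℂ (Y x) y + ψ.form.baseChange ℂ x (Y y) = 0) →
      LinearMap.trace ℂ _ (Y.restrict fun x (hx : x ∈ Module.End.eigenspace
          (((bettiCohomology.map φ.hom.hom.hom 1).hom).baseChange ℂ) (Complex.I * (Real.sqrt d : ℂ))) =>
        UnitaryTheta.apply_mem_eigenspace_of_commute hYφ hx) = 0 →
      Y ∈ (BettiUniverse.hodge exists_isReal_hodgeModel_holds (AbelianVariety.isSmoothProjective_holds (A := A)) 1).hodgeLieC)
    {v₀ : (ℂ ⊗[ℚ] bettiCohomology A.X 1) ≃ₗ[ℂ] (ℂ ⊗[ℚ] bettiCohomology A.X 1)}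
    (hvφ : (v₀ : Module.End ℂ (ℂ ⊗[ℚ] bettiCohomology A.X 1)) * ((bettiCohomology.map φ.hom.hom.hom 1).hom).baseChange ℂ =
      ((bettiCohomology.map φ.hom.hom.hom 1).hom).baseChange ℂ * (v₀ : Module.End ℂ (ℂ ⊗[ℚ] bettiCohomology A.X 1)))
    (hvψ : ∀ x y, ψ.form.baseChange ℂ (v₀ x) (v₀ y) = ψ.form.baseChange ℂ x y)
    (hdet : LinearMap.det ((v₀ : Module.End ℂ (ℂ ⊗[ℚ] bettiCohomology A.X 1)).restrict
      fun x (hx : x ∈ Module.End.eigenspace (((bettiCohomology.map φ.hom.hom.hom 1).hom).baseChange ℂ)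
        (Complex.I * (Real.sqrt d : ℂ))) => UnitaryTheta.apply_mem_eigenspace_of_commute hvφ hx) = 1) :
    (ofRatClassBaseChangeEquiv (AbelianVariety.isSmoothProjective_holds (A := A)) 1).symm.trans
        (v₀.trans (ofRatClassBaseChangeEquiv (AbelianVariety.isSmoothProjective_holds (A := A)) 1)) ∈
      hodgeGroupOne A.dim A.X := by
  classical
  -- the setting
  have hHD : exists_isReal_hodgeModel := exists_isReal_hodgeModel_holds
  have hI : hodgePQ_independent_of_hodgeModel := hodgePQ_independent_of_hodgeModel_holds
  have hX : IsSmoothProjective A.dim A.X := AbelianVariety.isSmoothProjective_holds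
  haveI : Module.Finite ℚ (bettiCohomology A.X 1) := finite_bettiCohomology_one A
  have hA : 0 < A.dim := by rw [h.dim_eq]; have := h.pos; omega
  have hdQ : (0 : ℚ) < d := Nat.cast_pos.2 h.d_pos
  have heff := BettiUniverse.hodge_isEffective hHD hX 1
  obtain ⟨hφE, hφ2, hE, hμ⟩ := h.bettiMapHom_facts_of_finrank_endAlgebra_eq_two hE2
  set φQ : Module.End ℚ (bettiCohomology A.X 1) := (bettiCohomology.map φ.hom.hom.hom 1).hom with hφQ
  set μ : ℂ := Complex.I * (Real.sqrt d : ℂ) with hμdef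
  obtain ⟨hμ0, -⟩ := UnitaryTheta.conj_eq_neg_of_sq hdQ hμ
  set ρ := ofRatClassBaseChangeEquiv hX 1 with hρ
  set v : complexBetti A.X 1 ≃ₗ[ℂ] complexBetti A.X 1 := ρ.symm.trans (v₀.trans ρ) with hvdef
  have hv_apply : ∀ z, v z = ρ (v₀ (ρ.symm z)) := fun z => rfl
  -- adapted dual bases
  obtain ⟨n₀, cb, κ, hcbW, hcbW', hcb0, hcb1, hdual⟩ := UnitaryTheta.exists_adaptedDualBasis
    (BettiUniverse.hodge hHD (AbelianVariety.isSmoothProjective_holds (A := A)) 1) Nat.cast_one heff ψ hφE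
    hdQ hφ2 hE hμ
  have hφcb : ∀ t ℓ, φQ.baseChange ℂ (cb (t, ℓ)) = (if t = 0 then μ else -μ) • cb (t, ℓ) := by
    intro t ℓ
    rcases fin2_eq_zero_or_one t with rfl | rfl
    · rw [if_pos rfl]; exact Module.End.mem_eigenspace_iff.1 (hcbW ℓ)
    · rw [if_neg one_ne_zero]; exact Module.End.mem_eigenspace_iff.1 (hcbW' ℓ)
  have hμμ : -μ ≠ μ := fun h' => hμ0 (by
    have h2 : (2 : ℂ) * μ = 0 := by rw [two_mul]; nth_rw 1 [← h']; exact neg_add_cancel μ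
    exact (mul_eq_zero.1 h2).resolve_left two_ne_zero)
  -- bases of `W`, `W̄` made of the letters
  obtain ⟨bW, hbW⟩ := exists_basis_eigenspace_of_block cb (f := φQ.baseChange ℂ)
    (ε := fun t => if t = 0 then μ else -μ) hφcb 0 (if_pos rfl) (fun t' ht' => by
      rcases fin2_eq_zero_or_one t' with rfl | rfl
      · exact absurd rfl ht'
      · rw [if_neg one_ne_zero]; exact hμμ)
  obtain ⟨bW', hbW'⟩ := exists_basis_eigenspace_of_block cb (f := φQ.baseChange ℂ)
    (ε := fun t => if t = 0 then μ else -μ) hφcb 1 (if_neg one_ne_zero) (fun t' ht' => by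
      rcases fin2_eq_zero_or_one t' with rfl | rfl
      · rw [if_pos rfl]; exact fun h' => hμμ h'.symm
      · exact absurd rfl ht')
  -- `v₀` preserves `W` and `W̄`; its matrices `M`, `N` on the letters
  have hvW : ∀ x ∈ Module.End.eigenspace (φQ.baseChange ℂ) μ, v₀ x ∈ Module.End.eigenspace (φQ.baseChange ℂ) μ :=
    fun x hx => UnitaryTheta.apply_mem_eigenspace_of_commute hvφ hx
  have hvW' : ∀ x ∈ Module.End.eigenspace (φQ.baseChange ℂ) (-μ),
      v₀ x ∈ Module.End.eigenspace (φQ.baseChange ℂ) (-μ) :=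
    fun x hx => UnitaryTheta.apply_mem_eigenspace_of_commute hvφ hx
  set M : Matrix (Fin n₀) (Fin n₀) ℂ := Matrix.of fun r ℓ => bW.repr ⟨v₀ (cb (0, ℓ)), hvW _ (hcbW ℓ)⟩ r with hMdef
  set N : Matrix (Fin n₀) (Fin n₀) ℂ := Matrix.of fun r ℓ => bW'.repr ⟨v₀ (cb (1, ℓ)), hvW' _ (hcbW' ℓ)⟩ r with hNdef
  have hM : ∀ ℓ, v₀ (cb (0, ℓ)) = ∑ r, M r ℓ • cb (0, r) := fun ℓ => by
    have hs := congrArg Subtype.val (bW.sum_repr ⟨v₀ (cb (0, ℓ)), hvW _ (hcbW ℓ)⟩)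
    rw [Submodule.coe_sum] at hs
    change _ = v₀ (cb (0, ℓ)) at hs
    rw [← hs]
    exact Finset.sum_congr rfl fun r _ => by rw [Submodule.coe_smul, hbW, hMdef, Matrix.of_apply]
  have hN : ∀ ℓ, v₀ (cb (1, ℓ)) = ∑ r, N r ℓ • cb (1, r) := fun ℓ => by
    have hs := congrArg Subtype.val (bW'.sum_repr ⟨v₀ (cb (1, ℓ)), hvW' _ (hcbW' ℓ)⟩)
    rw [Submodule.coe_sum] at hs
    change _ = v₀ (cb (1, ℓ)) at hs
    rw [← hs]
    exact Finset.sum_congr rfl fun r _ => by rw [Submodule.coe_smul, hbW', hNdef, Matrix.of_apply]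
  -- `det M = det(v₀|_W) = 1`
  have hdetM : M.det = 1 := by
    rw [← hdet]
    exact (det_restrict_eq_of_apply_eq_sum bW hbW _ M hM).symm
  -- `Mᵀ N = 1` (duality of the letters and `ψ_ℂ`-invariance), so `N = (M⁻¹)ᵀ`
  have hMN : Mᵀ * N = 1 := by
    ext i j
    have h1 := hvψ (cb (0, i)) (cb (1, j))
    rw [hM, hN, hdual] at h1
    simp only [map_sum, LinearMap.sum_apply, map_smul, LinearMap.smul_apply, smul_eq_mul, hdual, mul_ite, mul_one,
      mul_zero, Finset.sum_ite_eq', Finset.mem_univ, if_true] at h1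
    rw [Matrix.mul_apply, Matrix.one_apply, ← h1]
    exact Finset.sum_congr rfl fun r _ => by rw [Matrix.transpose_apply, mul_comm]
  have hNeq : N = (M⁻¹)ᵀ := by
    rw [Matrix.transpose_nonsing_inv, Matrix.inv_eq_right_inv hMN]
  -- the block family of `v₀` on the letters
  set Gm : Fin 2 → Matrix (Fin n₀) (Fin n₀) ℂ := fun t => if t = 0 then M else (M⁻¹)ᵀ with hGm
  have hv₀cb : ∀ t ℓ, v₀ (cb (t, ℓ)) = ∑ r, Gm t r ℓ • cb (t, r) := by
    intro t ℓ
    rcases fin2_eq_zero_or_one t with rfl | rfl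
    · simp only [hGm, if_pos rfl]; exact hM ℓ
    · simp only [hGm, if_neg one_ne_zero, ← hNeq]; exact hN ℓ
  -- the letters in `H¹(A(ℂ); ℂ)` and the action of `v` on them
  set x : Fin 2 × Fin n₀ → complexBetti A.X 1 := fun tl => ofRatClassBaseChange (Motives.ComplexPoints A.X) 1 (cb tl)
    with hxdef
  have hxρ : ∀ tl, x tl = ρ (cb tl) := fun tl => by rw [hxdef, hρ, ofRatClassBaseChangeEquiv_apply]
  have hvx : ∀ t ℓ, v (x (t, ℓ)) = ∑ r, Gm t r ℓ • x (t, r) := fun t ℓ => by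
    rw [hxρ, hv_apply, ρ.symm_apply_apply, hv₀cb, map_sum]
    exact Finset.sum_congr rfl fun r _ => by rw [map_smul, hxρ]
  -- `v` commutes with `φ^*`, hence with every pull-back (`End⁰(A) = K`): `v ∈ C(A)^×(ℂ)`
  have hvφ' : ∀ z, v (pullbackOne A φ z) = pullbackOne A φ (v z) := fun z => by
    rw [hv_apply, hv_apply]
    have h1 : ρ.symm (pullbackOne A φ z) = φQ.baseChange ℂ (ρ.symm z) := by
      apply ρ.injective
      rw [ρ.apply_symm_apply, hρ, ofRatClassBaseChangeEquiv_apply, hφQ, ofRatClassBaseChange_baseChange_bettiMapHom,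
        ← ofRatClassBaseChangeEquiv_apply hX, LinearEquiv.apply_symm_apply]
    have h2 : v₀ (φQ.baseChange ℂ (ρ.symm z)) = φQ.baseChange ℂ (v₀ (ρ.symm z)) := by
      have h3 := LinearMap.congr_fun hvφ (ρ.symm z)
      simpa only [Module.End.mul_apply, LinearEquiv.coe_coe] using h3
    rw [h1, h2, hρ, ofRatClassBaseChangeEquiv_apply, hφQ, ofRatClassBaseChange_baseChange_bettiMapHom,
      ← ofRatClassBaseChangeEquiv_apply hX]
  have hvC : v ∈ centralizerGroup A :=
    mem_centralizerGroup_of_comm_pullbackOne_of_finrank_endAlgebra_eq_two h.d_pos h.sq_eq hE2 hA hvφ'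
  -- `⋀•(v^{⊕(a+1)})` fixes every rational `(p,p)`-class of every power
  have key : ∀ (a p : ℕ) (c : complexBetti (A.powSucc a).X (2 * p)), IsRationalClass c →
      IsOfHodgeType (A.powSucc a).dim (A.powSucc a).X (2 * p) p p c → diagPowExterior A v a (2 * p) c = c := by
    intro a p c hcQ hc
    rcases Nat.eq_zero_or_pos p with rfl | hp
    · -- degree `0`: `c = t • 1` and `⋀⁰ = id` on `1`
      obtain ⟨t, rfl⟩ := exists_eq_smul_one_of_isSmoothProjective
        (AbelianVariety.isSmoothProjective_holds (A := A.powSucc a)) ℂ c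
      rw [map_smul]
      congr 1
      show diagPowExterior A v a 0 _ = _
      rw [diagPowExterior, exteriorPullbackEquiv_apply, exteriorPullback_one]
    · obtain ⟨cf, hcf, hkill⟩ := (AVSlots.powSucc A a).exists_slInvariant_coeff_of_hodgeLieC hHD hI ψ hφE hdQ hφ2 hE
        hμ hSU cb κ hcbW hcbW' hcb0 hcb1 hdual hp hcQ hc
      rw [← hcf, diagPowExterior_wordEval_avLetters_eq_wordEval_colourChangeAt hvC x Gm hvx a (2 * p) cf,
        colourChangeAt_eq_self_of_forall_wordSlice]
      intro U
      set ty : Fin (2 * p) → Bool := fun q => decide ((U q).2 = 0) with hty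
      have hfamG : (fun q => Gm (U q).2) = mixedGrpFamily ty M := by
        funext q
        by_cases hq : (U q).2 = 0
        · rw [hq, mixedGrpFamily_of_eq_true M (by simp [hty, hq])]
          exact if_pos rfl
        · have hq1 : (U q).2 = 1 := (fin2_eq_zero_or_one _).resolve_left hq
          rw [hq1, mixedGrpFamily_of_eq_false M (by simp [hty, hq1])]
          exact if_neg one_ne_zero
      rw [hfamG]
      refine wordRepAt_mixedGrpFamily_eq_self_of_forall_trace_of_det_eq_one ty (fun X hXtr => ?_) hdetM
      have hfam : mixedLieFamily ty X = fun t => if (U t).2 = 0 then X else -Xᵀ := by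
        funext t
        simp only [mixedLieFamily, hty, decide_eq_true_eq]
      rw [hfam]
      exact hkill U X hXtr
  have hmem := exteriorPullbackEquiv_mem_hodgeGroup_of_forall key
  exact mem_hodgeGroupOne_iff.2 ⟨_, hmem, exteriorPullbackEquiv_one_eq _ v⟩

end SUleHg

/-! ### §4 THE SOCKET: `S(A)(h)(ℂ) ∩ {det_W = 1} ⊆ Hg(A)(ℂ)|_{H¹}` — the displayed `hG` of the TABLE X Weil census files -/

section Socket

variable {A : AbelianVariety ℂ} {φ : A ⟶ A} {n d : ℕ}

open scoped Classical in
/-- **B5a — THE LIE-TO-GROUP PASSAGE FOR WEIL TYPE WITH `End⁰ = K` (socket `hG` of the TABLE X Weil census files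
`SixfoldTableXCensusWeilCMGeneralRows*` / `…WeilCentralKGeneral`).** Let `(A, φ)` be of Weil type `(n, d)` with
`finrank_ℚ End⁰(A) = 2`, `ψ` a polarization of `H¹(A(ℂ); ℚ)` with the DISPLAYED Lie hypothesis `hSU` (brick B4′: every
`φ_ℂ`-commuting `ψ_ℂ`-skew operator with trace `0` on `W = ker(φ_ℂ − i√d)` lies in `Lie Hg(H¹A) ⊗ ℂ`), and `h ∈ B¹(A) ⊗ ℂ`
a class with `Q_h = h^{dim A − 1} ⌣ (· ⌣ ·)` non-degenerate and `φ^*` a `d`-similitude of `Q_h` (as displayed by the census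
files). Then every `u ∈ S(A)(h)(ℂ) = unitaryCentralizerGroup A h` (commuting with `End(A)`, preserving `Q_h`) with
`det(u | W_{i√d}) = 1` lies in `Hg(A)(ℂ)|_{H¹} = hodgeGroupOne (dim A) A.X`. Proof: `φ^*` is `Q_h`-skew up to the similitude
factor, so `W = ker(φ^* − i√d)` and `W̄ = ker(φ^* + i√d)` are `Q_h`-ISOTROPIC; let `M` be the matrix of `u|_W` in adapted
`ψ_ℂ`-dual letters (`det M = 1`) and `v` the operator `(M, (M⁻¹)ᵀ)` on `W ⊕ W̄`: it commutes with `φ_ℂ`, preserves `ψ_ℂ`,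
has `det(v|_W) = 1`, so `v ∈ Hg|_{H¹}` by §3; `Hg|_{H¹} ≤ S(A)(h)` (`Milne1999.hodgeGroupOne_le_unitaryCentralizerGroup`), so
`u` and `v` both preserve `Q_h` and agree on `W`; for a letter `f` of `W̄`, `u f − v f ∈ W̄` is `Q_h`-orthogonal to
`u(W) = W`'s letters and to `W̄`, hence zero (`Q_h` non-degenerate): `u = v`. No comparison of `Q_h` with `ψ` is used.
NOT proved here: `hSU` itself (brick B4′), HC for any row. [cite: Deligne1982HodgeCycles, I §3 Prop. 3.4 and 3.6]
[cite: vanGeemen1994HodgeAV, 6.9, Lemma 6.10 and Thm. 6.11] [cite: Milne1999LefschetzClasses, §1 p. 644 and §4 p. 659]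
[cite: GoodmanWallachGTM255, Thm. 2.2.2 and Thm. 2.2.7 (2)] -/
theorem IsWeilType.mem_hodgeGroupOne_of_mem_unitaryCentralizerGroup_of_hodgeLieC [HodgeTensorFacts.{0, 0}]
    (hW : IsWeilType A φ n d) (hE2 : Module.finrank ℚ A.endAlgebra = 2)
    (ψ : (BettiUniverse.hodge exists_isReal_hodgeModel_holds (AbelianVariety.isSmoothProjective_holds (A := A)) 1).Polarization)
    (hSU : ∀ (Y : Module.End ℂ (ℂ ⊗[ℚ] bettiCohomology A.X 1))
      (hYφ : Y * ((bettiCohomology.map φ.hom.hom.hom 1).hom).baseChange ℂ =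
        ((bettiCohomology.map φ.hom.hom.hom 1).hom).baseChange ℂ * Y),
      (∀ x y, ψ.form.baseChange ℂ (Y x) y + ψ.form.baseChange ℂ x (Y y) = 0) →
      LinearMap.trace ℂ _ (Y.restrict fun x (hx : x ∈ Module.End.eigenspace
          (((bettiCohomology.map φ.hom.hom.hom 1).hom).baseChange ℂ) (Complex.I * (Real.sqrt d : ℂ))) =>
        UnitaryTheta.apply_mem_eigenspace_of_commute hYφ hx) = 0 →
      Y ∈ (BettiUniverse.hodge exists_isReal_hodgeModel_holds (AbelianVariety.isSmoothProjective_holds (A := A)) 1).hodgeLieC)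
    {h : complexBetti A.X 2} (hh : h ∈ hodgeClassSpan A.dim A.X 1)
    (hnd : ∀ x : complexBetti A.X 1, (∀ y, Motives.polarizationPairingOne A.X h (A.dim - 1) x y = 0) → x = 0)
    (hφQ : ∀ x y, Motives.polarizationPairingOne A.X h (A.dim - 1) (pullbackOne A φ x) (pullbackOne A φ y) =
      (d : ℂ) • Motives.polarizationPairingOne A.X h (A.dim - 1) x y)
    (u : complexBetti A.X 1 ≃ₗ[ℂ] complexBetti A.X 1) (hu : u ∈ unitaryCentralizerGroup A h)
    (hdet : detOnEigenspace u (pullbackOne A φ) (fun x ↦ (mem_centralizerGroup_iff.1 hu.1) φ x)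
      (Complex.I * (Real.sqrt d : ℂ)) = 1) :
    u ∈ hodgeGroupOne A.dim A.X := by
  classical
  -- the setting
  have hHD : exists_isReal_hodgeModel := exists_isReal_hodgeModel_holds
  have hX : IsSmoothProjective A.dim A.X := AbelianVariety.isSmoothProjective_holds
  haveI : Module.Finite ℚ (bettiCohomology A.X 1) := finite_bettiCohomology_one A
  have hdQ : (0 : ℚ) < d := Nat.cast_pos.2 hW.d_pos
  have heff := BettiUniverse.hodge_isEffective hHD hX 1
  obtain ⟨hφE, hφ2, hE, hμ⟩ := hW.bettiMapHom_facts_of_finrank_endAlgebra_eq_two hE2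
  set φQ : Module.End ℚ (bettiCohomology A.X 1) := (bettiCohomology.map φ.hom.hom.hom 1).hom with hφQdef
  set μ : ℂ := Complex.I * (Real.sqrt d : ℂ) with hμdef
  obtain ⟨hμ0, -⟩ := UnitaryTheta.conj_eq_neg_of_sq hdQ hμ
  have hμμ : -μ ≠ μ := fun h' => hμ0 (by
    have h2 : (2 : ℂ) * μ = 0 := by rw [two_mul]; nth_rw 1 [← h']; exact neg_add_cancel μ
    exact (mul_eq_zero.1 h2).resolve_left two_ne_zero)
  have hμ2 : μ * μ = -(d : ℂ) := by rw [← sq, hμ, Rat.cast_natCast]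
  set ρ := ofRatClassBaseChangeEquiv hX 1 with hρ
  set Q := Motives.polarizationPairingOne A.X h (A.dim - 1) with hQdef
  have hρφ : ∀ z, ρ (φQ.baseChange ℂ z) = pullbackOne A φ (ρ z) := fun z => by
    rw [hρ, ofRatClassBaseChangeEquiv_apply, ofRatClassBaseChangeEquiv_apply, hφQdef,
      ofRatClassBaseChange_baseChange_bettiMapHom]
  have hρφ' : ∀ z, ρ.symm (pullbackOne A φ z) = φQ.baseChange ℂ (ρ.symm z) := fun z => by
    apply ρ.injective
    rw [ρ.apply_symm_apply, hρφ, ρ.apply_symm_apply]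
  -- adapted dual bases and the letters in `H¹(A(ℂ); ℂ)`
  obtain ⟨n₀, cb, κ, hcbW, hcbW', hcb0, hcb1, hdual⟩ := UnitaryTheta.exists_adaptedDualBasis
    (BettiUniverse.hodge hHD (AbelianVariety.isSmoothProjective_holds (A := A)) 1) Nat.cast_one heff ψ hφE
    hdQ hφ2 hE hμ
  have hφcb : ∀ t ℓ, φQ.baseChange ℂ (cb (t, ℓ)) = (if t = 0 then μ else -μ) • cb (t, ℓ) := by
    intro t ℓ
    rcases fin2_eq_zero_or_one t with rfl | rfl
    · rw [if_pos rfl]; exact Module.End.mem_eigenspace_iff.1 (hcbW ℓ)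
    · rw [if_neg one_ne_zero]; exact Module.End.mem_eigenspace_iff.1 (hcbW' ℓ)
  set xb : Module.Basis (Fin 2 × Fin n₀) ℂ (complexBetti A.X 1) := cb.map ρ with hxb
  have hxb_apply : ∀ tl, xb tl = ρ (cb tl) := fun tl => by rw [hxb, Module.Basis.map_apply]
  have hφxb : ∀ t ℓ, pullbackOne A φ (xb (t, ℓ)) = (if t = 0 then μ else -μ) • xb (t, ℓ) := fun t ℓ => by
    rw [hxb_apply, ← hρφ, hφcb, map_smul]
  -- bases of `W ⊆ V_ℂ` (rational side) and of `W = ker(φ^* − i√d) ⊆ H¹(A(ℂ); ℂ)` made of the letters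
  obtain ⟨bW, hbW⟩ := exists_basis_eigenspace_of_block cb (f := φQ.baseChange ℂ)
    (ε := fun t => if t = 0 then μ else -μ) hφcb 0 (if_pos rfl) (fun t' ht' => by
      rcases fin2_eq_zero_or_one t' with rfl | rfl
      · exact absurd rfl ht'
      · rw [if_neg one_ne_zero]; exact hμμ)
  obtain ⟨bWc, hbWc⟩ := exists_basis_eigenspace_of_block xb (f := pullbackOne A φ)
    (ε := fun t => if t = 0 then μ else -μ) hφxb 0 (if_pos rfl) (fun t' ht' => by
      rcases fin2_eq_zero_or_one t' with rfl | rfl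
      · exact absurd rfl ht'
      · rw [if_neg one_ne_zero]; exact hμμ)
  -- the matrix `M` of `u|_W` on the letters; `det M = 1`
  have huφ : ∀ z, u (pullbackOne A φ z) = pullbackOne A φ (u z) := fun z => (mem_centralizerGroup_iff.1 hu.1) φ z
  have huW : ∀ x ∈ Module.End.eigenspace (pullbackOne A φ) μ, (u : complexBetti A.X 1 →ₗ[ℂ] complexBetti A.X 1) x ∈
      Module.End.eigenspace (pullbackOne A φ) μ :=
    fun x hx => VanGeemen1994.mapsTo_eigenspace_of_comm huφ μ hx
  have hxbW : ∀ ℓ, xb (0, ℓ) ∈ Module.End.eigenspace (pullbackOne A φ) μ := fun ℓ =>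
    Module.End.mem_eigenspace_iff.2 (by rw [hφxb, if_pos rfl])
  set M : Matrix (Fin n₀) (Fin n₀) ℂ := Matrix.of fun r ℓ => bWc.repr ⟨u (xb (0, ℓ)), huW _ (hxbW ℓ)⟩ r with hMdef
  have hMu : ∀ ℓ, u (xb (0, ℓ)) = ∑ r, M r ℓ • xb (0, r) := fun ℓ => by
    have hs := congrArg Subtype.val (bWc.sum_repr ⟨u (xb (0, ℓ)), huW _ (hxbW ℓ)⟩)
    rw [Submodule.coe_sum] at hs
    change _ = u (xb (0, ℓ)) at hs
    rw [← hs]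
    exact Finset.sum_congr rfl fun r _ => by rw [Submodule.coe_smul, hbWc, hMdef, Matrix.of_apply]
  have hdetM : M.det = 1 := by
    rw [← hdet]
    unfold detOnEigenspace
    exact (det_restrict_eq_of_apply_eq_sum bWc hbWc _ M hMu).symm
  have hMunit : IsUnit M.det := by rw [hdetM]; exact isUnit_one
  have hMinvM : M⁻¹ * M = 1 := Matrix.nonsing_inv_mul M hMunit
  -- the operator `v₀ = (M, (M⁻¹)ᵀ)` on `V_ℂ = W ⊕ W̄`
  set Gm : Fin 2 → Matrix (Fin n₀) (Fin n₀) ℂ := fun t => if t = 0 then M else (M⁻¹)ᵀ with hGm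
  have hGm0 : Gm 0 = M := if_pos rfl
  have hGm1 : Gm 1 = (M⁻¹)ᵀ := if_neg one_ne_zero
  set cbr : Module.Basis (Fin n₀ × Fin 2) ℂ (ℂ ⊗[ℚ] bettiCohomology A.X 1) :=
    cb.reindex (Equiv.prodComm (Fin 2) (Fin n₀)) with hcbr
  have hcbr_apply : ∀ ℓ t, cbr (ℓ, t) = cb (t, ℓ) := fun ℓ t => by
    rw [hcbr, Module.Basis.reindex_apply]; rfl
  set P : Matrix (Fin n₀ × Fin 2) (Fin n₀ × Fin 2) ℂ := Matrix.blockDiagonal Gm with hP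
  have hPunit : IsUnit (LinearMap.toMatrix cbr cbr (Matrix.toLin cbr cbr P)).det := by
    rw [LinearMap.toMatrix_toLin, hP, Matrix.det_blockDiagonal, Fin.prod_univ_two, hGm0, hGm1, Matrix.det_transpose,
      Matrix.det_nonsing_inv, hdetM, Ring.inverse_one, one_mul]
    exact isUnit_one
  set v₀ : (ℂ ⊗[ℚ] bettiCohomology A.X 1) ≃ₗ[ℂ] (ℂ ⊗[ℚ] bettiCohomology A.X 1) :=
    LinearEquiv.ofIsUnitDet hPunit with hv₀
  have hv₀cb : ∀ t ℓ, v₀ (cb (t, ℓ)) = ∑ r, Gm t r ℓ • cb (t, r) := fun t ℓ => by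
    rw [hv₀, LinearEquiv.ofIsUnitDet_apply, ← hcbr_apply, Matrix.toLin_self, Fintype.sum_prod_type_right,
      Finset.sum_eq_single t]
    · exact Finset.sum_congr rfl fun r _ => by rw [hP, Matrix.blockDiagonal_apply_eq, hcbr_apply]
    · intro t' _ ht'
      exact Finset.sum_eq_zero fun r _ => by rw [hP, Matrix.blockDiagonal_apply_ne _ _ _ ht', zero_smul]
    · intro ht; exact absurd (Finset.mem_univ t) ht
  -- `v₀` commutes with `φ_ℂ`
  have hv₀φ : (v₀ : Module.End ℂ (ℂ ⊗[ℚ] bettiCohomology A.X 1)) * φQ.baseChange ℂ =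
      φQ.baseChange ℂ * (v₀ : Module.End ℂ (ℂ ⊗[ℚ] bettiCohomology A.X 1)) := by
    refine cb.ext fun tl => ?_
    obtain ⟨t, ℓ⟩ := tl
    rw [Module.End.mul_apply, Module.End.mul_apply, LinearEquiv.coe_coe, hφcb, map_smul, hv₀cb, map_sum,
      Finset.smul_sum]
    exact Finset.sum_congr rfl fun r _ => by rw [map_smul, hφcb, smul_comm]
  -- `v₀` preserves `ψ_ℂ`
  set ψC := ψ.form.baseChange ℂ with hψC
  have hφskewC : ∀ x y, ψC (φQ.baseChange ℂ x) y + ψC x (φQ.baseChange ℂ y) = 0 := by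
    haveI : Nontrivial (bettiCohomology A.X 1) := by
      apply Module.nontrivial_of_finrank_pos (R := ℚ)
      rw [finrank_bettiCohomology_one A, hW.dim_eq]
      have := hW.pos; omega
    exact ThetaSubalgebra.formBaseChange_add_eq_zero_of_skew ψ
      (UnitaryTheta.form_apply_add_form_apply_eq_zero _ ψ hφE hdQ hφ2 hE)
  have hiso0 : ∀ i j, ψC (cb (0, i)) (cb (0, j)) = 0 := fun i j =>
    UnitaryTheta.form_eq_zero_of_mem_eigenspace hφskewC hμ0 (hcbW i) (hcbW j)
  have hiso1 : ∀ i j, ψC (cb (1, i)) (cb (1, j)) = 0 := fun i j =>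
    UnitaryTheta.form_eq_zero_of_mem_eigenspace hφskewC (neg_ne_zero.2 hμ0) (hcbW' i) (hcbW' j)
  have hswap10 : ∀ i j, ψC (cb (1, i)) (cb (0, j)) = -(if j = i then 1 else 0) := fun i j => by
    rw [hψC, ψ.form_baseChange_swap, show (((1 : ℕ) : ℤ)).negOnePow = -1 from Int.negOnePow_one, ← hψC, hdual]
    split_ifs <;> simp
  have hv₀ψ : ∀ x y, ψC (v₀ x) (v₀ y) = ψC x y := by
    have hB : ψC.compl₁₂ (v₀ : Module.End ℂ (ℂ ⊗[ℚ] bettiCohomology A.X 1))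
        (v₀ : Module.End ℂ (ℂ ⊗[ℚ] bettiCohomology A.X 1)) = ψC := by
      refine LinearMap.BilinForm.ext_basis cb fun tk tl => ?_
      obtain ⟨t, k⟩ := tk
      obtain ⟨t', ℓ⟩ := tl
      rw [LinearMap.compl₁₂_apply, LinearEquiv.coe_coe, hv₀cb, hv₀cb, bilin_apply_sum_smul_sum_smul]
      rcases fin2_eq_zero_or_one t with rfl | rfl <;> rcases fin2_eq_zero_or_one t' with rfl | rfl
      · simp only [hiso0, smul_zero, Finset.sum_const_zero]
      · -- `∑_r ∑_s M_{rk} (M⁻¹)ᵀ_{sℓ} δ_{rs} = (M⁻¹ M)_{ℓk} = δ_{kℓ}`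
        have e1 : ∀ r : Fin n₀, ∑ s, (Gm 0 r k * Gm 1 s ℓ) • ψC (cb (0, r)) (cb (1, s)) = M r k * M⁻¹ ℓ r := by
          intro r
          rw [Finset.sum_eq_single r]
          · rw [hdual, if_pos rfl, smul_eq_mul, mul_one, hGm0, hGm1, Matrix.transpose_apply]
          · intro s _ hs
            rw [hdual, if_neg (Ne.symm hs), smul_zero]
          · intro hr; exact absurd (Finset.mem_univ r) hr
        have e2 : ∑ r, M r k * M⁻¹ ℓ r = (M⁻¹ * M) ℓ k := by
          rw [Matrix.mul_apply]; exact Finset.sum_congr rfl fun r _ => mul_comm _ _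
        rw [Finset.sum_congr rfl fun r _ => e1 r, e2, hMinvM, Matrix.one_apply, hdual]
        by_cases hkl : k = ℓ
        · rw [if_pos hkl, if_pos hkl.symm]
        · rw [if_neg hkl, if_neg (Ne.symm hkl)]
      · -- `∑_r ∑_s (M⁻¹)ᵀ_{rk} M_{sℓ} (−δ_{sr}) = −(M⁻¹ M)_{kℓ} = −δ_{kℓ}`
        have e1 : ∀ r : Fin n₀, ∑ s, (Gm 1 r k * Gm 0 s ℓ) • ψC (cb (1, r)) (cb (0, s)) = -(M⁻¹ k r * M r ℓ) := by
          intro r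
          rw [Finset.sum_eq_single r]
          · rw [hswap10, if_pos rfl, smul_neg, smul_eq_mul, mul_one, hGm0, hGm1, Matrix.transpose_apply]
          · intro s _ hs
            rw [hswap10, if_neg hs, neg_zero, smul_zero]
          · intro hr; exact absurd (Finset.mem_univ r) hr
        have e2 : ∑ r, -(M⁻¹ k r * M r ℓ) = -(M⁻¹ * M) k ℓ := by
          rw [Finset.sum_neg_distrib, Matrix.mul_apply]
        rw [Finset.sum_congr rfl fun r _ => e1 r, e2, hMinvM, Matrix.one_apply, hswap10]
        by_cases hkl : k = ℓ
        · rw [if_pos hkl, if_pos hkl.symm]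
        · rw [if_neg hkl, if_neg (Ne.symm hkl)]
      · simp only [hiso1, smul_zero, Finset.sum_const_zero]
    intro x y
    have e := LinearMap.congr_fun (LinearMap.congr_fun hB x) y
    rw [LinearMap.compl₁₂_apply, LinearEquiv.coe_coe] at e
    exact e
  -- `det(v₀|_W) = det M = 1`
  have hv₀det : LinearMap.det ((v₀ : Module.End ℂ (ℂ ⊗[ℚ] bettiCohomology A.X 1)).restrict
      fun x (hx : x ∈ Module.End.eigenspace (φQ.baseChange ℂ) μ) =>
        UnitaryTheta.apply_mem_eigenspace_of_commute hv₀φ hx) = 1 := by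
    rw [det_restrict_eq_of_apply_eq_sum bW hbW _ M (fun ℓ => by rw [LinearEquiv.coe_coe, hv₀cb, hGm0]), hdetM]
  -- §3: the transport `v` of `v₀` lies in `Hg|_{H¹}`, hence in `S(A)(h)`
  have hvHg := hW.trans_mem_hodgeGroupOne_of_preserves_polarization_of_det_eq_one hE2 ψ hSU hv₀φ hv₀ψ hv₀det
  set v : complexBetti A.X 1 ≃ₗ[ℂ] complexBetti A.X 1 := ρ.symm.trans (v₀.trans ρ) with hvdef
  have hv_apply : ∀ z, v z = ρ (v₀ (ρ.symm z)) := fun z => rfl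
  have hvS : v ∈ unitaryCentralizerGroup A h := hodgeGroupOne_le_unitaryCentralizerGroup hh hvHg
  have hvxb : ∀ t ℓ, v (xb (t, ℓ)) = ∑ r, Gm t r ℓ • xb (t, r) := fun t ℓ => by
    rw [hxb_apply, hv_apply, ρ.symm_apply_apply, hv₀cb, map_sum]
    exact Finset.sum_congr rfl fun r _ => by rw [map_smul, hxb_apply]
  -- `u = v`: they agree on the letters of `W` …
  have huv0 : ∀ ℓ, u (xb (0, ℓ)) = v (xb (0, ℓ)) := fun ℓ => by rw [hMu, hvxb, hGm0]
  -- … `W̄` is `Q_h`-isotropic …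
  have hisoQ : ∀ y ∈ Module.End.eigenspace (pullbackOne A φ) (-μ), ∀ y' ∈ Module.End.eigenspace (pullbackOne A φ) (-μ),
      Q y y' = 0 := by
    intro y hy y' hy'
    rw [Module.End.mem_eigenspace_iff] at hy hy'
    have h1 := hφQ y y'
    rw [hy, hy', map_smul, LinearMap.map_smul₂, smul_smul, neg_mul_neg, hμ2] at h1
    have h2 : ((2 : ℂ) * (d : ℂ)) • Q y y' = 0 := by
      rw [mul_smul, two_smul]
      nth_rw 1 [← h1]
      rw [neg_smul, neg_add_cancel]
    rcases smul_eq_zero.1 h2 with h3 | h3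
    · exfalso
      exact mul_ne_zero two_ne_zero (Nat.cast_ne_zero.2 hW.d_pos.ne') h3
    · exact h3
  have hxbW' : ∀ ℓ, xb (1, ℓ) ∈ Module.End.eigenspace (pullbackOne A φ) (-μ) := fun ℓ =>
    Module.End.mem_eigenspace_iff.2 (by rw [hφxb, if_neg one_ne_zero])
  have hvφ : ∀ z, v (pullbackOne A φ z) = pullbackOne A φ (v z) := fun z => (mem_centralizerGroup_iff.1 hvS.1) φ z
  -- … so they agree on the letters of `W̄` (`Q_h` non-degenerate)
  have huv1 : ∀ ℓ, u (xb (1, ℓ)) = v (xb (1, ℓ)) := by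
    intro ℓ
    rw [← sub_eq_zero]
    apply hnd
    -- `Q_h(u f − v f, u z) = 0` for every `z`, and `u` is onto
    suffices hcomp : Q (u (xb (1, ℓ)) - v (xb (1, ℓ))) ∘ₗ (u : complexBetti A.X 1 →ₗ[ℂ] complexBetti A.X 1) = 0 by
      intro y
      obtain ⟨z, rfl⟩ := u.surjective y
      have e := LinearMap.congr_fun hcomp z
      rwa [LinearMap.comp_apply, LinearEquiv.coe_coe, LinearMap.zero_apply] at e
    refine xb.ext fun tk => ?_
    obtain ⟨t, k⟩ := tk
    rw [LinearMap.comp_apply, LinearEquiv.coe_coe, LinearMap.zero_apply, map_sub, LinearMap.sub_apply]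
    rcases fin2_eq_zero_or_one t with rfl | rfl
    · -- on `u(W)`: both `u` and `v` preserve `Q_h` and agree on `W`
      rw [hu.2, huv0, hvS.2, sub_self]
    · -- on `u(W̄) ⊆ W̄`: isotropy
      have hmem : ∀ w : complexBetti A.X 1 ≃ₗ[ℂ] complexBetti A.X 1, (∀ z, w (pullbackOne A φ z) = pullbackOne A φ (w z)) →
          ∀ ℓ', w (xb (1, ℓ')) ∈ Module.End.eigenspace (pullbackOne A φ) (-μ) :=
        fun w hw ℓ' => VanGeemen1994.mapsTo_eigenspace_of_comm hw (-μ) (hxbW' ℓ')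
      rw [hisoQ _ (hmem u huφ ℓ) _ (hmem u huφ k), hisoQ _ (hmem v hvφ ℓ) _ (hmem u huφ k), sub_self]
  have huv : u = v := by
    refine LinearEquiv.ext fun z => ?_
    have e : (u : complexBetti A.X 1 →ₗ[ℂ] complexBetti A.X 1) = (v : complexBetti A.X 1 →ₗ[ℂ] complexBetti A.X 1) := by
      refine xb.ext fun tk => ?_
      obtain ⟨t, k⟩ := tk
      rcases fin2_eq_zero_or_one t with rfl | rfl
      · exact huv0 k
      · exact huv1 k
    exact LinearMap.congr_fun e z
  rw [huv]
  exact hvHg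

end Socket

/-! ### §5 Van Geemen's `Hg = SU_H` for every member with `End⁰ = K`, under the Lie hypothesis -/

section HasSU

variable {A : AbelianVariety ℂ} {φ : A ⟶ A} {n d : ℕ}

/-- **`Hg(A)(ℂ)|_{H¹} = SU_H(ℂ)` (van Geemen's `HasHodgeGroupSU A φ n d h`) for EVERY Weil-type `(A, φ)` with `End⁰(A) = K`,
under the displayed Lie hypothesis `hSU` (brick B4′)**, for every class `h ∈ B¹(A) ⊗ ℂ` with `Q_h` non-degenerate and `φ^*` a
`d`-similitude of `Q_h`: `⊆` is the tree's `VanGeemen1994.hodgeGroupOne_le_weilSpecialUnitaryGroup` (van Geemen 6.11, first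
step; Moonen–Zarhin's criterion), `⊇` is §4 (an element of `SU_H(ℂ)` commutes with `φ^*`, hence with `End(A)` as `End⁰ = K`,
§2b). With B4′ this discharges the hypothesis of van Geemen's Theorem 6.12 for such members (socket (a) of the census file
`SixfoldTableXCensusWeilGeneralRow`); HC is NOT thereby proved. [cite: vanGeemen1994HodgeAV, Thm. 6.11 and Thm. 6.12]
[cite: MoonenZarhin1998WeilClasses, §1 Criterion and Remark] [cite: Deligne1982HodgeCycles, I §3 Prop. 3.4 and 3.6] -/
theorem IsWeilType.hasHodgeGroupSU_of_hodgeLieC [HodgeTensorFacts.{0, 0}]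
    (hW : IsWeilType A φ n d) (hE2 : Module.finrank ℚ A.endAlgebra = 2)
    (ψ : (BettiUniverse.hodge exists_isReal_hodgeModel_holds (AbelianVariety.isSmoothProjective_holds (A := A)) 1).Polarization)
    (hSU : ∀ (Y : Module.End ℂ (ℂ ⊗[ℚ] bettiCohomology A.X 1))
      (hYφ : Y * ((bettiCohomology.map φ.hom.hom.hom 1).hom).baseChange ℂ =
        ((bettiCohomology.map φ.hom.hom.hom 1).hom).baseChange ℂ * Y),
      (∀ x y, ψ.form.baseChange ℂ (Y x) y + ψ.form.baseChange ℂ x (Y y) = 0) →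
      LinearMap.trace ℂ _ (Y.restrict fun x (hx : x ∈ Module.End.eigenspace
          (((bettiCohomology.map φ.hom.hom.hom 1).hom).baseChange ℂ) (Complex.I * (Real.sqrt d : ℂ))) =>
        UnitaryTheta.apply_mem_eigenspace_of_commute hYφ hx) = 0 →
      Y ∈ (BettiUniverse.hodge exists_isReal_hodgeModel_holds (AbelianVariety.isSmoothProjective_holds (A := A)) 1).hodgeLieC)
    {h : complexBetti A.X 2} (hh : h ∈ hodgeClassSpan A.dim A.X 1)
    (hnd : ∀ x : complexBetti A.X 1, (∀ y, Motives.polarizationPairingOne A.X h (A.dim - 1) x y = 0) → x = 0)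
    (hφQ : ∀ x y, Motives.polarizationPairingOne A.X h (A.dim - 1) (pullbackOne A φ x) (pullbackOne A φ y) =
      (d : ℂ) • Motives.polarizationPairingOne A.X h (A.dim - 1) x y) :
    HasHodgeGroupSU A φ n d h := by
  refine le_antisymm ((VanGeemen1994.hodgeGroupOne_le_weilSpecialUnitaryGroup_iff_isWeilType hW.pos hW.d_pos hW.dim_eq
    hW.sq_eq hh).2 hW) fun u hu => ?_
  obtain ⟨hc, hQ, hdet, -⟩ := hu
  have hA : 0 < A.dim := by rw [hW.dim_eq]; have := hW.pos; omega
  have hdim : A.dim - 1 = 2 * n - 1 := by rw [hW.dim_eq]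
  have hu' : u ∈ unitaryCentralizerGroup A h := by
    refine ⟨mem_centralizerGroup_of_comm_pullbackOne_of_finrank_endAlgebra_eq_two hW.d_pos hW.sq_eq hE2 hA hc, ?_⟩
    have key : ∀ j : ℕ, j = 2 * n - 1 → ∀ x y, Motives.polarizationPairingOne A.X h j (u x) (u y) =
        Motives.polarizationPairingOne A.X h j x y := by
      rintro j rfl; exact hQ
    exact key _ hdim
  exact hW.mem_hodgeGroupOne_of_mem_unitaryCentralizerGroup_of_hodgeLieC hE2 ψ hSU hh hnd hφQ u hu' hdet

end HasSU

/-! ### §6 The `h_K` instance: the displayed hypothesis `HasHodgeGroupSU A φ n d h_K` of the row-9 census file from the Lie hypothesis alone -/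

section KSymm

variable {A : AbelianVariety ℂ} {φ : A ⟶ A} {n d : ℕ}

/-- **Van Geemen's `Hg = SU_H` for the `K`-symmetrised hyperplane class `h_K = d·e^*a + φ^*e^*a`, from the Lie hypothesis
alone** — the displayed hypothesis `HasHodgeGroupSU A φ n d (hK d φ e a)` of the census file `SixfoldTableXCensusWeilGeneralRow`
(and of van Geemen's Theorem 6.12 as typed) for EVERY Weil-type `(A, φ)` with `End⁰(A) = K`, MODULO the displayed B4′ hypothesis
`hSU`: §5 with the tree's facts on `h_K` — rational of type `(1,1)` (`isRationalClass_ksymm`, `isOfHodgeType_one_one_ksymm`: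
a real multiple of a Kähler class), `Q_{h_K}` non-degenerate (`VanGeemen1994.eq_zero_of_forall_polarizationPairingOne_ksymm_eq_zero`,
second Riemann condition, van Geemen Lemma 5.2 (2)) and `φ^*` a `d`-similitude of `Q_{h_K}` (`polarizationPairingOne_map_map_ksymm`,
Lemma 5.2 (1)). HC is NOT thereby proved (for row 9 it needs the algebraicity of the Weil plane, rung H2).
[cite: vanGeemen1994HodgeAV, Lemma 5.2 (1)–(2), 6.9, Thm. 6.11 and Thm. 6.12] [cite: Deligne1982HodgeCycles, I §3 Prop. 3.4 and 3.6] -/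
theorem IsWeilType.hasHodgeGroupSU_ksymm_of_hodgeLieC [HodgeTensorFacts.{0, 0}]
    (hW : IsWeilType A φ n d) (hE2 : Module.finrank ℚ A.endAlgebra = 2)
    (ψ : (BettiUniverse.hodge exists_isReal_hodgeModel_holds (AbelianVariety.isSmoothProjective_holds (A := A)) 1).Polarization)
    (hSU : ∀ (Y : Module.End ℂ (ℂ ⊗[ℚ] bettiCohomology A.X 1))
      (hYφ : Y * ((bettiCohomology.map φ.hom.hom.hom 1).hom).baseChange ℂ =
        ((bettiCohomology.map φ.hom.hom.hom 1).hom).baseChange ℂ * Y),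
      (∀ x y, ψ.form.baseChange ℂ (Y x) y + ψ.form.baseChange ℂ x (Y y) = 0) →
      LinearMap.trace ℂ _ (Y.restrict fun x (hx : x ∈ Module.End.eigenspace
          (((bettiCohomology.map φ.hom.hom.hom 1).hom).baseChange ℂ) (Complex.I * (Real.sqrt d : ℂ))) =>
        UnitaryTheta.apply_mem_eigenspace_of_commute hYφ hx) = 0 →
      Y ∈ (BettiUniverse.hodge exists_isReal_hodgeModel_holds (AbelianVariety.isSmoothProjective_holds (A := A)) 1).hodgeLieC)
    (e : Motives.ProjectiveEmbedding A.X) {a : complexBetti (Motives.projectiveSpace e.n ℂ) 2} (ha : IsRationalClass a)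
    (ha0 : a ≠ 0) :
    HasHodgeGroupSU A φ n d (VanGeemen1994.hK d φ e a) := by
  -- `dim A = m + 1` with `m = 2n − 1 ≥ 1`
  obtain ⟨m, hAm⟩ : ∃ m, A.dim = m + 1 := ⟨2 * n - 1, by rw [hW.dim_eq]; have := hW.pos; omega⟩
  have hm : 1 ≤ m := by have h1 := hW.pos; have h2 := hW.dim_eq; omega
  have hj : A.dim - 1 = m := by omega
  -- `h_K ∈ B¹(A) ⊗ ℂ`
  have h11 : IsOfHodgeType A.dim A.X (2 * 1) 1 1 (VanGeemen1994.hK d φ e a) := by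
    rw [hAm]; exact isOfHodgeType_one_one_ksymm hAm hW.d_pos φ e ha ha0
  have hh : VanGeemen1994.hK d φ e a ∈ hodgeClassSpan A.dim A.X 1 :=
    Submodule.subset_span ⟨isRationalClass_ksymm d φ e ha, h11⟩
  -- `Q_{h_K}` non-degenerate and `φ^*` a `d`-similitude (exponent `A.dim − 1 = m`)
  have hnd : ∀ j : ℕ, j = m → ∀ x : complexBetti A.X 1,
      (∀ y, Motives.polarizationPairingOne A.X (VanGeemen1994.hK d φ e a) j x y = 0) → x = 0 := by
    rintro j rfl x hx
    exact VanGeemen1994.eq_zero_of_forall_polarizationPairingOne_ksymm_eq_zero hm hAm hW.d_pos φ e ha ha0 hx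
  have hφQ : ∀ j : ℕ, j = m → ∀ x y, Motives.polarizationPairingOne A.X (VanGeemen1994.hK d φ e a) j
      (pullbackOne A φ x) (pullbackOne A φ y) = (d : ℂ) • Motives.polarizationPairingOne A.X (VanGeemen1994.hK d φ e a) j x y := by
    rintro j rfl x y
    exact polarizationPairingOne_map_map_ksymm hAm hW.d_pos hW.sq_eq e a x y
  exact hW.hasHodgeGroupSU_of_hodgeLieC hE2 ψ hSU hh (hnd _ hj) (hφQ _ hj)

end KSymm

end Literature.AlgebraicGeometry.HodgeTheory

end
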